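import Literature.Computability.Complexity.HardcoreInapproximabilitySecondMomentShift
import HarnessLib

/-!
# The second-moment ratio of Sly's slice partition function: per-factor bounds and the explicit bound

For the core with `q` big matchings on `N = n + m'` ports (boundary occupying `ep` plus and `em`
minus ports) and one small matching on `n`, `E[Z_{a,b}(η)²]/(E Z_{a,b}(η))² = Σ_{g,h} A(g,h)
ρ_big(g,h)^q ρ_small(g,h)` (`slyRatioGen`). Per-factor near bounds (`slyRho_near_le`,
`slyAcoef_near_le`), the general near term (`slyNearTermGen_le`), the combined planar lattice form
(`slySAgen, slySBgen, slySCgen`, `slyGen_lattice`), the overlap rate under boundary shifts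
(`abs_nfA_shift_le`), the general far term (`slyFarTermGen_le`), the shift of the big colour's
deviation (`abs_big_dev_sub_le`), and the explicit bound `slyRatioGen_le_explicit` (near terms in
Gaussian form `slyNearGen_gauss_le` summed by the two-dimensional lattice bound, far terms
`slyFarGen_le` by the cone bounds of both colours).

## References
* [Sly2010] A. Sly, FOCS 2010 / arXiv:1005.5584, Lemma 3.5 and §3.3.
* [MosselWeitzWormald2008] E. Mossel, D. Weitz, N. Wormald, PTRF 143 (2009), §5, Theorem 6.11.
-/

namespace Literature.Computability.Complexity

open Real Finset Literature.Analysis.SpecialFunctions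

section RhoNear

variable {α β : ℝ}

set_option maxHeartbeats 3200000 in
/-- **The colour factor near the product point**: for a colour with parameters `(N, a, b)` (densities
`α = a/N`, `β = b/N`) and overlaps `(g, h)` within `c₀ w` of `(α², β²) N`,
`ρ(g,h) ≤ e^{N M_B(h₁,h₂)} · KB · Θ` with `KB = e^{Pref_B(c*)/2} κ₃^{-1/2}` and
`Θ = e^{E₁} (1+τ₃) + (N+1) e^{-Nκw²/(2d) + 5(log N/2 + 2)}/KB`. [cite: MosselWeitzWormald2008, proof of Theorem 6.11; Sly2010, proof of Lemma 3.5] -/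
theorem slyRho_near_le (d : ℕ) (hd : 1 ≤ d) {N a b g h μ : ℕ} {m κ η r₀ w c₀ : ℝ}
    (hN : 1 ≤ N) (hga : g ≤ a) (hhb : h ≤ b) (hbN : b + b - h ≤ N) (habN : a + b < N)
    (hα : (a : ℝ) = N * α) (hβ : (b : ℝ) = N * β) (hα0 : 0 < α) (hβ0 : 0 < β) (hαβ : α + β < 1)
    (hm : m = min (min α β) (1 - α - β)) (hκ : 0 < κ) (hw : 0 < w) (hc₀1 : c₀ ≤ 1)
    (hPD : ∀ h₁ h₂ h₃ : ℝ, slyQ d α β h₁ h₂ h₃ ≤ -κ * (h₁ ^ 2 + h₂ ^ 2 + h₃ ^ 2))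
    (hgap : ∀ c ∈ slyPolytope α β, r₀ ≤ dist c (slyCstar α β) →
      slyRate d α β c.1 c.2.1 c.2.2 ≤ -η)
    (hr₀ : 3 * r₀ ≤ m ^ 2 / 2) (hr₀κ : 12 * (4 + 7 * (d : ℝ)) * (8 * r₀) ≤ κ / 4 * m ^ 4)
    (hQ : 3 * ((d : ℝ) + 2) / m ^ 5 * c₀ ^ 2 ≤ κ / 8) (hcube : 48 * c₀ ^ 3 * w ≤ κ / 8 * m ^ 4)
    (hηw : κ * w ^ 2 ≤ η) (hw2 : 2 * w ≤ m ^ 2 / 4) (hμ1 : 1 ≤ μ) (hμ : (μ : ℝ) ≤ N * (m ^ 2 / 2))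
    (hnear : |(g : ℝ) / N - α ^ 2| + |(h : ℝ) / N - β ^ 2| ≤ c₀ * w) :
    slyRho N a b g h ≤
      Real.exp (N * slyMB α β ((g : ℝ) / N - α ^ 2) ((h : ℝ) / N - β ^ 2)) *
        (Real.exp (slyPrefB α β (α ^ 2) (β ^ 2) (α * (1 - α - β)) / 2) / Real.sqrt (slyK3 α β)) *
        (Real.exp (180 * N * (2 * w) ^ 3 / m ^ 4 + 19 * (2 * w) / (2 * (m ^ 2 / 2)) + 11 / (6 * (μ : ℝ))) *
            (1 + 2 / (rexp (π ^ 2 / (slyK3 α β / (2 * N))) - 1)) +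
          ((N : ℝ) + 1) * Real.exp (-(N * κ * w ^ 2 / (2 * d)) + 5 * (Real.log N / 2 + 2)) /
            (Real.exp (slyPrefB α β (α ^ 2) (β ^ 2) (α * (1 - α - β)) / 2) / Real.sqrt (slyK3 α β))) := by
  -- notation and basic facts
  have hN0 : 0 < N := hN
  have hNR : (0 : ℝ) < N := by exact_mod_cast hN0
  have hdR : (0 : ℝ) < d := by exact_mod_cast hd
  have hm0 : 0 < m := by rw [hm]; exact lt_min (lt_min hα0 hβ0) (by linarith)
  have hκ3 := slyK3_pos hα0 hβ0 hαβ
  set KB : ℝ := Real.exp (slyPrefB α β (α ^ 2) (β ^ 2) (α * (1 - α - β)) / 2) / Real.sqrt (slyK3 α β)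
    with hKB
  have hKB0 : 0 < KB := by rw [hKB]; exact div_pos (Real.exp_pos _) (Real.sqrt_pos.mpr hκ3)
  set τ₃ : ℝ := 1 + 2 / (rexp (π ^ 2 / (slyK3 α β / (2 * N))) - 1) with hτ₃
  have hτ₃1 : 1 ≤ τ₃ := one_le_thetaFactor (by positivity)
  -- the degenerate case `g > F₀`
  by_cases hgF : g ≤ N - (b + b - h)
  swap
  · rw [slyRho_eq_zero_of_lt (not_le.mp hgF)]
    positivity
  set γ : ℝ := (g : ℝ) / N with hγ
  set δ : ℝ := (h : ℝ) / N with hδ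
  set h₁ : ℝ := γ - α ^ 2 with hh₁
  set h₂ : ℝ := δ - β ^ 2 with hh₂
  set εs : ℝ := α * (1 - α - β) with hεs
  set sgh : ℝ := |h₁| + |h₂| with hsgh
  have hs0 : 0 ≤ sgh := by positivity
  have hsw : sgh ≤ c₀ * w := hnear
  have hcw : c₀ * w ≤ w := by nlinarith
  have eα : (a : ℝ) / N = α := by rw [hα]; field_simp
  have eβ : (b : ℝ) / N = β := by rw [hβ]; field_simp
  set m₀ : ℝ := m ^ 2 / 2 with hm₀
  have hm₀0 : 0 < m₀ := by positivity
  have hcwm : c₀ * w ≤ m ^ 2 / 2 := by linarith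
  -- cells at `c*` and near
  have Hc0 := slyCells_cstar_ge hα0 hβ0 hαβ hm
  have hcell0 : ∀ u ∈ slyCells α β (α ^ 2) (β ^ 2) εs, m₀ ≤ u := fun u hu => by
    have := Hc0 u hu; rw [hm₀]; nlinarith [sq_nonneg m]
  have hcell : ∀ e : ℕ, e ≤ a - g → |(e : ℝ) / N - εs| ≤ w →
      ∀ u ∈ slyCells α β γ δ ((e : ℝ) / N), m₀ ≤ u := by
    intro e _ hew
    apply slyCells_near_ge hα0 hβ0 hαβ hm
    rw [← hh₁, ← hh₂]; linarith
  have hint : ∀ e : ℕ, e ≤ a - g → |(e : ℝ) / N - εs| ≤ w →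
      (μ ≤ g ∧ g + μ ≤ N - (b + b - h)) ∧ (μ ≤ e ∧ e + μ ≤ N - (b + b - h) - g) ∧
      (μ ≤ a - g - e ∧ a - g - e + μ ≤ b - h) ∧ (μ ≤ a - g ∧ a - g + μ ≤ N - b - g - e) ∧
      (μ ≤ a ∧ a - g + μ ≤ N - a ∧ a + μ ≤ N - b) := by
    intro e he hew
    have hc := hcell e he hew
    rw [hγ, hδ, ← eα, ← eβ] at hc
    exact slyInterior_of_cells hN0 hhb hbN hμ hc
  -- the far gap
  have hfar : ∀ e : ℕ, e ≤ a - g → w < |(e : ℝ) / N - εs| → slyT N a b g h e ≠ 0 →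
      N * slyGrate α β γ δ ((e : ℝ) / N) ≤ N * slyMB α β h₁ h₂ - N * κ * w ^ 2 / (2 * d) := by
    intro e he hew ht
    have hpoly := mem_slyPolytope_of_slyT_ne_zero hN0 hga hhb hbN hgF he ht
    rw [eα, eβ] at hpoly
    have hfg := slyFar_gap d hα0 hβ0 hαβ hm hκ hw hc₀1 hPD hgap hr₀ hr₀κ hcwm hQ hcube hηw hpoly
      (by rw [← hγ, ← hδ, ← hh₁, ← hh₂]; exact hsw) hew
    rw [← hγ, ← hδ, ← hh₁, ← hh₂] at hfg
    have h1 : slyGrate α β γ δ ((e : ℝ) / N) - slyMB α β h₁ h₂ ≤ -(κ / 2 * w ^ 2) / d := by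
      rw [le_div_iff₀ hdR]; linarith
    have h2 := mul_le_mul_of_nonneg_left h1 hNR.le
    have e1 : (N : ℝ) * (-(κ / 2 * w ^ 2) / d) = -(N * κ * w ^ 2 / (2 * d)) := by
      field_simp
    linarith
  -- the inner sum
  have hwin : |(g : ℝ) / N - α ^ 2| + |(h : ℝ) / N - β ^ 2| + w ≤ (min (min α β) (1 - α - β)) ^ 2 / 2 := by
    rw [← hm, ← hγ, ← hδ, ← hh₁, ← hh₂]; linarith
  have hInner := slyInner_sum_le hN hga hhb hbN habN hα hβ hα0 hβ0 hαβ hw.le hwin hμ1 hint hm₀0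
    hcell0 hcell hfar
  rw [← hγ, ← hδ, ← hh₁, ← hh₂, ← hεs, ← hm] at hInner
  have hσ2 : |h₁| + |h₂| + w ≤ 2 * w := by linarith
  have hE₁ : 180 * N * (|h₁| + |h₂| + w) ^ 3 / m ^ 4 + 19 * (|h₁| + |h₂| + w) / (2 * m₀) +
      11 / (6 * (μ : ℝ)) ≤
      180 * N * (2 * w) ^ 3 / m ^ 4 + 19 * (2 * w) / (2 * (m ^ 2 / 2)) + 11 / (6 * (μ : ℝ)) := by
    have hσ0 : 0 ≤ |h₁| + |h₂| + w := by positivity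
    have c1 : (|h₁| + |h₂| + w) ^ 3 ≤ (2 * w) ^ 3 := pow_le_pow_left₀ hσ0 hσ2 3
    have t1 : 180 * N * (|h₁| + |h₂| + w) ^ 3 / m ^ 4 ≤ 180 * N * (2 * w) ^ 3 / m ^ 4 := by
      apply div_le_div_of_nonneg_right _ (by positivity)
      exact mul_le_mul_of_nonneg_left c1 (by positivity)
    have t2 : 19 * (|h₁| + |h₂| + w) / (2 * m₀) ≤ 19 * (2 * w) / (2 * (m ^ 2 / 2)) := by
      rw [hm₀]; apply div_le_div_of_nonneg_right _ (by positivity); linarith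
    linarith
  set MB := slyMB α β h₁ h₂ with hMB
  unfold slyRho
  refine le_trans hInner ?_
  have e1 : Real.exp (N * MB + slyPrefB α β (α ^ 2) (β ^ 2) εs / 2 +
      (180 * N * (|h₁| + |h₂| + w) ^ 3 / m ^ 4 + 19 * (|h₁| + |h₂| + w) / (2 * m₀) +
        11 / (6 * (μ : ℝ)))) * (1 / Real.sqrt (slyK3 α β)) * τ₃ =
      Real.exp (N * MB) * KB * (Real.exp (180 * N * (|h₁| + |h₂| + w) ^ 3 / m ^ 4 +
        19 * (|h₁| + |h₂| + w) / (2 * m₀) + 11 / (6 * (μ : ℝ))) * τ₃) := by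
    rw [hKB, Real.exp_add, Real.exp_add]; ring
  have e2 : ((a - g + 1 : ℕ) : ℝ) * Real.exp (N * MB - N * κ * w ^ 2 / (2 * d) +
      5 * (Real.log N / 2 + 2)) = Real.exp (N * MB) * KB *
      (((a - g + 1 : ℕ) : ℝ) * Real.exp (-(N * κ * w ^ 2 / (2 * d)) + 5 * (Real.log N / 2 + 2)) / KB) := by
    rw [show (N : ℝ) * MB - N * κ * w ^ 2 / (2 * d) + 5 * (Real.log N / 2 + 2) =
      N * MB + (-(N * κ * w ^ 2 / (2 * d)) + 5 * (Real.log N / 2 + 2)) by ring, Real.exp_add]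
    field_simp
  rw [e1, e2, ← mul_add]
  apply mul_le_mul_of_nonneg_left _ (by positivity)
  apply add_le_add
  · exact mul_le_mul_of_nonneg_right (Real.exp_le_exp.mpr hE₁) (by linarith)
  · apply div_le_div_of_nonneg_right _ hKB0.le
    apply mul_le_mul_of_nonneg_right _ (Real.exp_pos _).le
    have : a - g + 1 ≤ N + 1 := by omega
    exact_mod_cast this

end RhoNear

section AcoefNear

variable {α β : ℝ}

set_option maxHeartbeats 3200000 in
/-- **The overlap factor near the product point**:
`A(g,h) ≤ e^{n Q₀(h₁,h₂,0)} (2πn)⁻¹ e^{Pref_A(c*)/2} e^{θ_A}`,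
`θ_A = 48 n (c₀w)³/m⁴ + 8 c₀ w/m² + 2/μ`. [cite: MosselWeitzWormald2008, proof of Theorem 6.11] -/
theorem slyAcoef_near_le {n a b g h μ : ℕ} {m w c₀ : ℝ}
    (hn : 1 ≤ n) (hga : g ≤ a) (hhb : h ≤ b) (habN : a + b < n)
    (hα : (a : ℝ) = n * α) (hβ : (b : ℝ) = n * β) (hα0 : 0 < α) (hβ0 : 0 < β) (hαβ : α + β < 1)
    (hm : m = min (min α β) (1 - α - β)) (hw : 0 < w) (hc₀1 : c₀ ≤ 1)
    (hw2 : 2 * w ≤ m ^ 2 / 4) (hμ1 : 1 ≤ μ) (hμ : (μ : ℝ) ≤ n * (m ^ 2 / 2))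
    (hnear : |(g : ℝ) / n - α ^ 2| + |(h : ℝ) / n - β ^ 2| ≤ c₀ * w) :
    slyAcoef n a b g h ≤ Real.exp (n * slyQ 0 α β ((g : ℝ) / n - α ^ 2) ((h : ℝ) / n - β ^ 2) 0) *
      ((2 * π * n)⁻¹ * Real.exp (slyPrefA α β (α ^ 2) (β ^ 2) / 2)) *
      Real.exp (48 * n * (c₀ * w) ^ 3 / m ^ 4 + 8 * (c₀ * w) / (m ^ 2 / 2) / 2 + 2 / (μ : ℝ)) := by
  have hn0 : 0 < n := hn
  have hnR : (0 : ℝ) < n := by exact_mod_cast hn0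
  have hm0 : 0 < m := by rw [hm]; exact lt_min (lt_min hα0 hβ0) (by linarith)
  set γ : ℝ := (g : ℝ) / n with hγ
  set δ : ℝ := (h : ℝ) / n with hδ
  set h₁ : ℝ := γ - α ^ 2 with hh₁
  set h₂ : ℝ := δ - β ^ 2 with hh₂
  set sgh : ℝ := |h₁| + |h₂| with hsgh
  have hs0 : 0 ≤ sgh := by positivity
  have hsw : sgh ≤ c₀ * w := hnear
  have hcw : c₀ * w ≤ w := by nlinarith
  have eα : (a : ℝ) / n = α := by rw [hα]; field_simp
  have eβ : (b : ℝ) / n = β := by rw [hβ]; field_simp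
  set m₀ : ℝ := m ^ 2 / 2 with hm₀
  have hm₀0 : 0 < m₀ := by positivity
  have HA0 := slyCellsA_cstar_ge hα0 hβ0 hαβ hm
  have hcA0 : ∀ u ∈ slyCellsA α β (α ^ 2) (β ^ 2), m₀ ≤ u := fun u hu => by
    have := HA0 u hu; rw [hm₀]; nlinarith [sq_nonneg m]
  have hcA : ∀ u ∈ slyCellsA α β γ δ, m₀ ≤ u := by
    apply slyCellsA_near_ge hα0 hβ0 hαβ hm
    rw [← hh₁, ← hh₂]; linarith
  have hintA := slyInteriorA_of_cells (a := a) (b := b) (g := g) (h := h) hn0 hμ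
    (by rw [eα, eβ]; exact hcA)
  obtain ⟨⟨kA1, kA1', kA2'⟩, ⟨kA3, kA3', kA4'⟩⟩ := hintA
  have hAint := log_slyAcoef_interior hga hhb (by omega) (by omega) hμ1 kA1 kA1' kA2' kA3 kA3' kA4'
  rw [eα, eβ, ← hγ, ← hδ, abs_le] at hAint
  have hs12 : |h₁| + |h₂| + |(0:ℝ)| ≤ m ^ 2 / 2 := by rw [abs_zero, add_zero]; linarith
  have T0 := abs_slyRate_sub_slyQ_le 0 hα0 hβ0 hαβ hm rfl hs12
  rw [abs_zero, add_zero, abs_le] at T0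
  push_cast at T0
  norm_num at T0
  have hfA : slyFA α β γ δ = slyRate 0 α β (α ^ 2 + h₁) (β ^ 2 + h₂) (α * (1 - α - β) + 0) := by
    rw [slyRate_zero_eq_slyFA, hh₁, hh₂]; ring_nf
  rw [add_zero] at hfA
  have hPA := abs_slyPrefA_sub_le (α := α) (β := β) hm₀0 hcA hcA0
  rw [abs_le, ← hh₁, ← hh₂] at hPA
  have hcube0 : 48 * ((|h₁| + |h₂|) ^ 3 / m ^ 4) ≤ 48 * (c₀ * w) ^ 3 / m ^ 4 := by
    rw [mul_div_assoc]
    apply mul_le_mul_of_nonneg_left _ (by norm_num)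
    apply div_le_div_of_nonneg_right _ (by positivity)
    exact pow_le_pow_left₀ hs0 hsw 3
  have hlogA : Real.log (slyAcoef n a b g h) ≤ n * slyQ 0 α β h₁ h₂ 0 +
      (48 * n * (c₀ * w) ^ 3 / m ^ 4 + 8 * (c₀ * w) / (m ^ 2 / 2) / 2 + 2 / (μ : ℝ)) +
      slyPrefA α β (α ^ 2) (β ^ 2) / 2 - Real.log (2 * π * n) := by
    have h1 : slyFA α β γ δ ≤ slyQ 0 α β h₁ h₂ 0 + 48 * ((|h₁| + |h₂|) ^ 3 / m ^ 4) := by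
      rw [hfA]; linarith [T0.2]
    have h2 := mul_le_mul_of_nonneg_left h1 hnR.le
    have h3 : (8:ℝ) * ((|h₁| + |h₂|) / m₀) ≤ 8 * (c₀ * w) / (m ^ 2 / 2) := by
      rw [hm₀, mul_div_assoc]
      exact mul_le_mul_of_nonneg_left (div_le_div_of_nonneg_right hsw (by positivity)) (by norm_num)
    have h4 := mul_le_mul_of_nonneg_left hcube0 hnR.le
    have e5 : (n : ℝ) * (slyQ 0 α β h₁ h₂ 0 + 48 * ((|h₁| + |h₂|) ^ 3 / m ^ 4)) =
        n * slyQ 0 α β h₁ h₂ 0 + n * (48 * ((|h₁| + |h₂|) ^ 3 / m ^ 4)) := by ring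
    have e6 : (n : ℝ) * (48 * (c₀ * w) ^ 3 / m ^ 4) = 48 * n * (c₀ * w) ^ 3 / m ^ 4 := by ring
    linarith [hAint.2, hPA.2]
  have hA0 : 0 ≤ slyAcoef n a b g h := by unfold slyAcoef; positivity
  refine le_trans (le_exp_log_of_nonneg hA0) ?_
  have : Real.exp (Real.log (slyAcoef n a b g h)) ≤ Real.exp (n * slyQ 0 α β h₁ h₂ 0 +
      (48 * n * (c₀ * w) ^ 3 / m ^ 4 + 8 * (c₀ * w) / (m ^ 2 / 2) / 2 + 2 / (μ : ℝ)) +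
      slyPrefA α β (α ^ 2) (β ^ 2) / 2 - Real.log (2 * π * n)) := Real.exp_le_exp.mpr hlogA
  refine le_trans this (le_of_eq ?_)
  simp only [hm₀]
  rw [Real.exp_sub, Real.exp_add, Real.exp_add, Real.exp_log (by positivity)]
  field_simp

end AcoefNear

section GenDefs

/-- **The second-moment ratio of Sly's slice partition function `Z_{a,b}(η)`** in the core with
`q` big matchings on `N = n + m'` (boundary occupying `ep` plus and `em` minus ports) and one small
matching on `n`: `E[Z²]/(EZ)² = Σ_{g,h} A(g,h) ρ_big(g,h)^q ρ_small(g,h)` with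
`ρ_big(g,h) = ρ(N, a+ep, b+em, g+ep, h+em)`. [cite: Sly2010, proof of Lemma 3.5, eq. (e:gt2Moment)] -/
noncomputable def slyRatioGen (n N q a b ep em : ℕ) : ℝ :=
  ∑ g ∈ range (a + 1), ∑ h ∈ range (b + 1),
    slyAcoef n a b g h * slyRho N (a + ep) (b + em) (g + ep) (h + em) ^ q * slyRho n a b g h

variable (q : ℕ) (θ α β α' β' : ℝ)

/-- Entry `A` of the combined planar lattice form (small densities `(α,β)`, big densities `(α',β')`,
`θ = n/N`). [folklore] -/
noncomputable def slySAgen : ℝ :=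
  -((α - 2) / (α * (α - 1) ^ 2) - 1 / α ^ 2 + slyM11 α β + q * θ * slyM11 α' β')

/-- Entry `B` of the combined planar lattice form. [folklore] -/
noncomputable def slySBgen : ℝ := -(slyM12 α β + q * θ * slyM12 α' β')

/-- Entry `C` of the combined planar lattice form. [folklore] -/
noncomputable def slySCgen : ℝ := -(-1 / (β ^ 2 * (1 - β) ^ 2) + slyM22 α β + q * θ * slyM22 α' β')

variable {q θ α β α' β'}

/-- With equal densities and `θ = 1` the combined form is the planar form with `d = q + 1`. [folklore] -/
theorem slySgen_eq_of_eq :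
    slySAgen q 1 α β α β = slySA (q + 1) α β ∧ slySBgen q 1 α β α β = slySB (q + 1) α β ∧
      slySCgen q 1 α β α β = slySC (q + 1) α β := by
  unfold slySAgen slySBgen slySCgen slySA slySB slySC slyM11 slyM12 slyM22
  push_cast
  refine ⟨by ring, by ring, by ring⟩

/-- **The combined exponent in lattice coordinates**: with `x = (g - nα², h - nβ²)`,
`n Q₀(x/n) + n M_B(x/n) + q N M_B'(x/N) = -(A x₁² + 2B x₁x₂ + C x₂²)/(2n)`. [folklore] -/
theorem slyGen_lattice {n N : ℕ} (hn : 0 < n) (hN : 0 < N) (hα : 0 < α) (hβ : 0 < β)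
    (hαβ : α + β < 1) (x₁ x₂ : ℝ) :
    (n : ℝ) * slyQ 0 α β (x₁ / n) (x₂ / n) 0 + n * slyMB α β (x₁ / n) (x₂ / n) +
        q * (N * slyMB α' β' (x₁ / N) (x₂ / N)) =
      -((slySAgen q ((n : ℝ) / N) α β α' β' * x₁ ^ 2 + 2 * slySBgen q ((n : ℝ) / N) α β α' β' * x₁ * x₂ +
        slySCgen q ((n : ℝ) / N) α β α' β' * x₂ ^ 2) / (2 * n)) := by
  have hnR : (n : ℝ) ≠ 0 := by exact_mod_cast hn.ne'
  have hNR : (N : ℝ) ≠ 0 := by exact_mod_cast hN.ne'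
  have h1 : (1 - α) ≠ 0 := by intro h; linarith
  have h1' : (α - 1) ≠ 0 := by intro h; linarith
  have h2 : (1 - β) ≠ 0 := by intro h; linarith
  have h3 : (1 - α - β) ≠ 0 := by intro h; linarith
  have hα' : α ≠ 0 := hα.ne'
  have hβ' : β ≠ 0 := hβ.ne'
  rw [slyMB_eq_form, slyMB_eq_form]
  unfold slySAgen slySBgen slySCgen slyQ
  push_cast
  field_simp
  ring

end GenDefs

section NearGen

variable {α β α' β' : ℝ}

set_option maxHeartbeats 3200000 in
/-- **A near term of the general outer sum** (`q` big colours with densities `(α', β')` and overlaps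
shifted by the boundary, one small colour): the product of `slyAcoef_near_le`, `slyRho_near_le`
for the big colour (to the power `q`) and for the small colour. [cite: Sly2010, proof of Lemma 3.5] -/
theorem slyNearTermGen_le (q : ℕ) {n N a b ep em g h μ μ' : ℕ} {m m' κ η η' r₀ w c₀ c₀' : ℝ}
    (hn : 1 ≤ n) (hN : 1 ≤ N) (hga : g ≤ a) (hhb : h ≤ b) (hbN : b + b - h ≤ n) (habN : a + b < n)
    (hbN' : (b + em) + (b + em) - (h + em) ≤ N) (habN' : (a + ep) + (b + em) < N)
    (hα : (a : ℝ) = n * α) (hβ : (b : ℝ) = n * β) (hα0 : 0 < α) (hβ0 : 0 < β) (hαβ : α + β < 1)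
    (hα' : ((a + ep : ℕ) : ℝ) = N * α') (hβ' : ((b + em : ℕ) : ℝ) = N * β') (hα0' : 0 < α')
    (hβ0' : 0 < β') (hαβ' : α' + β' < 1)
    (hm : m = min (min α β) (1 - α - β)) (hm' : m' = min (min α' β') (1 - α' - β'))
    (hκ : 0 < κ) (hw : 0 < w) (hc₀1 : c₀ ≤ 1) (hc₀1' : c₀' ≤ 1)
    (hPD : ∀ h₁ h₂ h₃ : ℝ, slyQ (q + 1) α β h₁ h₂ h₃ ≤ -κ * (h₁ ^ 2 + h₂ ^ 2 + h₃ ^ 2))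
    (hPD' : ∀ h₁ h₂ h₃ : ℝ, slyQ (q + 1) α' β' h₁ h₂ h₃ ≤ -κ * (h₁ ^ 2 + h₂ ^ 2 + h₃ ^ 2))
    (hgap : ∀ c ∈ slyPolytope α β, r₀ ≤ dist c (slyCstar α β) →
      slyRate (q + 1) α β c.1 c.2.1 c.2.2 ≤ -η)
    (hgap' : ∀ c ∈ slyPolytope α' β', r₀ ≤ dist c (slyCstar α' β') →
      slyRate (q + 1) α' β' c.1 c.2.1 c.2.2 ≤ -η')
    (hr₀ : 3 * r₀ ≤ m ^ 2 / 2) (hr₀m' : 3 * r₀ ≤ m' ^ 2 / 2)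
    (hr₀κ : 12 * (4 + 7 * ((q + 1 : ℕ) : ℝ)) * (8 * r₀) ≤ κ / 4 * m ^ 4)
    (hr₀κ' : 12 * (4 + 7 * ((q + 1 : ℕ) : ℝ)) * (8 * r₀) ≤ κ / 4 * m' ^ 4)
    (hQ : 3 * (((q + 1 : ℕ) : ℝ) + 2) / m ^ 5 * c₀ ^ 2 ≤ κ / 8)
    (hQ' : 3 * (((q + 1 : ℕ) : ℝ) + 2) / m' ^ 5 * c₀' ^ 2 ≤ κ / 8)
    (hcube : 48 * c₀ ^ 3 * w ≤ κ / 8 * m ^ 4) (hcube' : 48 * c₀' ^ 3 * w ≤ κ / 8 * m' ^ 4)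
    (hηw : κ * w ^ 2 ≤ η) (hηw' : κ * w ^ 2 ≤ η') (hw2 : 2 * w ≤ m ^ 2 / 4) (hw2' : 2 * w ≤ m' ^ 2 / 4)
    (hμ1 : 1 ≤ μ) (hμ : (μ : ℝ) ≤ n * (m ^ 2 / 2)) (hμ1' : 1 ≤ μ') (hμ' : (μ' : ℝ) ≤ N * (m' ^ 2 / 2))
    (hnear : |(g : ℝ) / n - α ^ 2| + |(h : ℝ) / n - β ^ 2| ≤ c₀ * w)
    (hnear' : |((g + ep : ℕ) : ℝ) / N - α' ^ 2| + |((h + em : ℕ) : ℝ) / N - β' ^ 2| ≤ c₀' * w) :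
    slyAcoef n a b g h * slyRho N (a + ep) (b + em) (g + ep) (h + em) ^ q * slyRho n a b g h ≤
      Real.exp (n * slyQ 0 α β ((g : ℝ) / n - α ^ 2) ((h : ℝ) / n - β ^ 2) 0 +
          n * slyMB α β ((g : ℝ) / n - α ^ 2) ((h : ℝ) / n - β ^ 2) +
          q * (N * slyMB α' β' (((g + ep : ℕ) : ℝ) / N - α' ^ 2) (((h + em : ℕ) : ℝ) / N - β' ^ 2))) *
        ((2 * π * n)⁻¹ * Real.exp (slyPrefA α β (α ^ 2) (β ^ 2) / 2) *
          (Real.exp (slyPrefB α' β' (α' ^ 2) (β' ^ 2) (α' * (1 - α' - β')) / 2) / Real.sqrt (slyK3 α' β')) ^ q *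
          (Real.exp (slyPrefB α β (α ^ 2) (β ^ 2) (α * (1 - α - β)) / 2) / Real.sqrt (slyK3 α β))) *
        (Real.exp (48 * n * (c₀ * w) ^ 3 / m ^ 4 + 8 * (c₀ * w) / (m ^ 2 / 2) / 2 + 2 / (μ : ℝ)) *
          (Real.exp (180 * N * (2 * w) ^ 3 / m' ^ 4 + 19 * (2 * w) / (2 * (m' ^ 2 / 2)) + 11 / (6 * (μ' : ℝ))) *
              (1 + 2 / (rexp (π ^ 2 / (slyK3 α' β' / (2 * N))) - 1)) +
            ((N : ℝ) + 1) * Real.exp (-(N * κ * w ^ 2 / (2 * (q + 1 : ℕ))) + 5 * (Real.log N / 2 + 2)) /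
              (Real.exp (slyPrefB α' β' (α' ^ 2) (β' ^ 2) (α' * (1 - α' - β')) / 2) / Real.sqrt (slyK3 α' β'))) ^ q *
          (Real.exp (180 * n * (2 * w) ^ 3 / m ^ 4 + 19 * (2 * w) / (2 * (m ^ 2 / 2)) + 11 / (6 * (μ : ℝ))) *
              (1 + 2 / (rexp (π ^ 2 / (slyK3 α β / (2 * n))) - 1)) +
            ((n : ℝ) + 1) * Real.exp (-(n * κ * w ^ 2 / (2 * (q + 1 : ℕ))) + 5 * (Real.log n / 2 + 2)) /
              (Real.exp (slyPrefB α β (α ^ 2) (β ^ 2) (α * (1 - α - β)) / 2) / Real.sqrt (slyK3 α β)))) := by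
  have hd : 1 ≤ q + 1 := by omega
  have hA := slyAcoef_near_le hn hga hhb habN hα hβ hα0 hβ0 hαβ hm hw hc₀1 hw2 hμ1 hμ hnear
  have hR := slyRho_near_le (q + 1) hd hn hga hhb hbN habN hα hβ hα0 hβ0 hαβ hm hκ hw hc₀1 hPD hgap
    hr₀ hr₀κ hQ hcube hηw hw2 hμ1 hμ hnear
  have hR' := slyRho_near_le (q + 1) hd hN (by omega : g + ep ≤ a + ep) (by omega : h + em ≤ b + em)
    hbN' habN' hα' hβ' hα0' hβ0' hαβ' hm' hκ hw hc₀1' hPD' hgap' hr₀m' hr₀κ' hQ' hcube' hηw' hw2'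
    hμ1' hμ' hnear'
  have hA0 : 0 ≤ slyAcoef n a b g h := by unfold slyAcoef; positivity
  have hR0 : 0 ≤ slyRho n a b g h := by
    unfold slyRho; exact sum_nonneg fun e _ => by unfold slyB0 slyT; positivity
  have hR0' : 0 ≤ slyRho N (a + ep) (b + em) (g + ep) (h + em) := by
    unfold slyRho; exact sum_nonneg fun e _ => by unfold slyB0 slyT; positivity
  -- abbreviations
  set EA := Real.exp (n * slyQ 0 α β ((g : ℝ) / n - α ^ 2) ((h : ℝ) / n - β ^ 2) 0) with hEA
  set EB := Real.exp (n * slyMB α β ((g : ℝ) / n - α ^ 2) ((h : ℝ) / n - β ^ 2)) with hEB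
  set EB' := Real.exp (N * slyMB α' β' (((g + ep : ℕ) : ℝ) / N - α' ^ 2) (((h + em : ℕ) : ℝ) / N - β' ^ 2))
    with hEB'
  set CA := (2 * π * n)⁻¹ * Real.exp (slyPrefA α β (α ^ 2) (β ^ 2) / 2) with hCA
  set KB := Real.exp (slyPrefB α β (α ^ 2) (β ^ 2) (α * (1 - α - β)) / 2) / Real.sqrt (slyK3 α β) with hKB
  set KB' := Real.exp (slyPrefB α' β' (α' ^ 2) (β' ^ 2) (α' * (1 - α' - β')) / 2) / Real.sqrt (slyK3 α' β')
    with hKB'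
  set TA := Real.exp (48 * n * (c₀ * w) ^ 3 / m ^ 4 + 8 * (c₀ * w) / (m ^ 2 / 2) / 2 + 2 / (μ : ℝ)) with hTA
  set Θ := Real.exp (180 * n * (2 * w) ^ 3 / m ^ 4 + 19 * (2 * w) / (2 * (m ^ 2 / 2)) + 11 / (6 * (μ : ℝ))) *
      (1 + 2 / (rexp (π ^ 2 / (slyK3 α β / (2 * n))) - 1)) +
    ((n : ℝ) + 1) * Real.exp (-(n * κ * w ^ 2 / (2 * (q + 1 : ℕ))) + 5 * (Real.log n / 2 + 2)) / KB with hΘ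
  set Θ' := Real.exp (180 * N * (2 * w) ^ 3 / m' ^ 4 + 19 * (2 * w) / (2 * (m' ^ 2 / 2)) + 11 / (6 * (μ' : ℝ))) *
      (1 + 2 / (rexp (π ^ 2 / (slyK3 α' β' / (2 * N))) - 1)) +
    ((N : ℝ) + 1) * Real.exp (-(N * κ * w ^ 2 / (2 * (q + 1 : ℕ))) + 5 * (Real.log N / 2 + 2)) / KB' with hΘ'
  have hκ3 := slyK3_pos hα0 hβ0 hαβ
  have hκ3' := slyK3_pos hα0' hβ0' hαβ'
  have hKB0 : 0 < KB := div_pos (Real.exp_pos _) (Real.sqrt_pos.mpr hκ3)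
  have hKB0' : 0 < KB' := div_pos (Real.exp_pos _) (Real.sqrt_pos.mpr hκ3')
  have h1 : 1 ≤ 1 + 2 / (rexp (π ^ 2 / (slyK3 α β / (2 * n))) - 1) := one_le_thetaFactor (by positivity)
  have h1' : 1 ≤ 1 + 2 / (rexp (π ^ 2 / (slyK3 α' β' / (2 * N))) - 1) := one_le_thetaFactor (by positivity)
  have hΘ0 : 0 ≤ Θ := by positivity
  have hΘ0' : 0 ≤ Θ' := by positivity
  calc slyAcoef n a b g h * slyRho N (a + ep) (b + em) (g + ep) (h + em) ^ q * slyRho n a b g h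
      ≤ (EA * CA * TA) * (EB' * KB' * Θ') ^ q * (EB * KB * Θ) := by
        apply mul_le_mul (mul_le_mul hA (pow_le_pow_left₀ hR0' hR' q) (by positivity) (by positivity))
          hR hR0 (by positivity)
    _ = (EA * EB * EB' ^ q) * (CA * KB' ^ q * KB) * (TA * Θ' ^ q * Θ) := by
        rw [mul_pow, mul_pow]; ring
    _ = _ := by
        rw [hEA, hEB, hEB', ← Real.exp_add, ← Real.exp_nat_mul, ← Real.exp_add]

end NearGen

section FarGen

set_option maxHeartbeats 1600000 in
/-- **The overlap rate under boundary shifts**: the six entropy forms of `A(g,h)` for the big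
colour's parameters `(N, a+ep, b+em, g+ep, h+em)` differ from those of `(n, a, b, g, h)`,
`N = n + m'`, `ep, em ≤ m'`, by at most `14 m' (1 + log N)`. [cite: Sly2010, Lemma 3.5 (the boundary corrections)] -/
theorem abs_nfA_shift_le {n N mm a b g h ep em : ℕ} (hn : 0 < n) (hNn : N = n + mm)
    (hep : ep ≤ mm) (hem : em ≤ mm) (hga : g ≤ a) (hhb : h ≤ b) (han : a ≤ n) (hbn : b ≤ n)
    (hPn : a - g ≤ n - a) (hAn : b - h ≤ n - b) :
    |(N : ℝ) * slyFA (((a + ep : ℕ) : ℝ) / N) (((b + em : ℕ) : ℝ) / N) (((g + ep : ℕ) : ℝ) / N)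
          (((h + em : ℕ) : ℝ) / N) -
        n * slyFA ((a : ℝ) / n) ((b : ℝ) / n) ((g : ℝ) / n) ((h : ℝ) / n)| ≤
      14 * mm * (1 + Real.log N) := by
  have hN : 0 < N := by omega
  rw [← slyAcoef_entropy_eq hN (by omega : g + ep ≤ a + ep) (by omega : h + em ≤ b + em)
    (by omega : a + ep ≤ N) (by omega : b + em ≤ N), ← slyAcoef_entropy_eq hn hga hhb han hbn]
  have hL : 0 ≤ 1 + Real.log N := by
    have : (1:ℝ) ≤ N := by exact_mod_cast hN
    linarith [Real.log_nonneg this]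
  have hepR : (ep : ℝ) ≤ mm := by exact_mod_cast hep
  have hemR : (em : ℝ) ≤ mm := by exact_mod_cast hem
  have hep0 : (0 : ℝ) ≤ ep := Nat.cast_nonneg ep
  have hem0 : (0 : ℝ) ≤ em := Nat.cast_nonneg em
  have hmm0 : (0 : ℝ) ≤ mm := Nat.cast_nonneg mm
  -- the six shifted entropy forms (all arguments at most `N`)
  have e1 := abs_entB_nat_sub_le (m := a) (k := g) (m' := a + ep) (k' := g + ep) (M := N) hga (by omega)
    (by omega) (by omega)
  have e2 := abs_entB_nat_sub_le (m := n - a) (k := a - g) (m' := N - (a + ep)) (k' := a + ep - (g + ep))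
    (M := N) hPn (by omega) (by omega) (by omega)
  have e3 := abs_entB_nat_sub_le (m := n) (k := a) (m' := N) (k' := a + ep) (M := N) han (by omega)
    (by omega) le_rfl
  have e4 := abs_entB_nat_sub_le (m := b) (k := h) (m' := b + em) (k' := h + em) (M := N) hhb (by omega)
    (by omega) (by omega)
  have e5 := abs_entB_nat_sub_le (m := n - b) (k := b - h) (m' := N - (b + em)) (k' := b + em - (h + em))
    (M := N) hAn (by omega) (by omega) (by omega)
  have e6 := abs_entB_nat_sub_le (m := n) (k := b) (m' := N) (k' := b + em) (M := N) hbn (by omega)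
    (by omega) le_rfl
  -- the shifts
  have c1 : ((a + ep : ℕ) : ℝ) - a = ep := by push_cast; ring
  have c2 : ((g + ep : ℕ) : ℝ) - g = ep := by push_cast; ring
  have c3 : ((a + ep - (g + ep) : ℕ) : ℝ) - ((a - g : ℕ) : ℝ) = 0 := by
    rw [show a + ep - (g + ep) = a - g by omega]; ring
  have c4 : ((N - (a + ep) : ℕ) : ℝ) - ((n - a : ℕ) : ℝ) = mm - ep := by
    rw [Nat.cast_sub (by omega : a + ep ≤ N), Nat.cast_sub han, hNn]; push_cast; ring
  have c5 : ((N - (a + ep) - (a + ep - (g + ep)) : ℕ) : ℝ) - ((n - a - (a - g) : ℕ) : ℝ) = mm - ep := by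
    rw [show a + ep - (g + ep) = a - g by omega, Nat.cast_sub (by omega : a - g ≤ N - (a + ep)),
      Nat.cast_sub hPn, Nat.cast_sub (by omega : a + ep ≤ N), Nat.cast_sub han, hNn]; push_cast; ring
  have c6 : (N : ℝ) - n = mm := by rw [hNn]; push_cast; ring
  have d1 : ((b + em : ℕ) : ℝ) - b = em := by push_cast; ring
  have d2 : ((h + em : ℕ) : ℝ) - h = em := by push_cast; ring
  have d3 : ((b + em - (h + em) : ℕ) : ℝ) - ((b - h : ℕ) : ℝ) = 0 := by
    rw [show b + em - (h + em) = b - h by omega]; ring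
  have d4 : ((N - (b + em) : ℕ) : ℝ) - ((n - b : ℕ) : ℝ) = mm - em := by
    rw [Nat.cast_sub (by omega : b + em ≤ N), Nat.cast_sub hbn, hNn]; push_cast; ring
  have d5 : ((N - (b + em) - (b + em - (h + em)) : ℕ) : ℝ) - ((n - b - (b - h) : ℕ) : ℝ) = mm - em := by
    rw [show b + em - (h + em) = b - h by omega, Nat.cast_sub (by omega : b - h ≤ N - (b + em)),
      Nat.cast_sub hAn, Nat.cast_sub (by omega : b + em ≤ N), Nat.cast_sub hbn, hNn]; push_cast; ring
  rw [c1, c2, c3] at e1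
  rw [c4, c3, c5] at e2
  rw [c6, c1, c4] at e3
  rw [d1, d2, d3] at e4
  rw [d4, d3, d5] at e5
  rw [c6, d1, d4] at e6
  rw [abs_zero, abs_of_nonneg hep0] at e1
  rw [abs_zero, abs_of_nonneg (by linarith : (0:ℝ) ≤ mm - ep)] at e2
  rw [abs_of_nonneg hmm0, abs_of_nonneg hep0, abs_of_nonneg (by linarith : (0:ℝ) ≤ mm - ep)] at e3
  rw [abs_zero, abs_of_nonneg hem0] at e4
  rw [abs_zero, abs_of_nonneg (by linarith : (0:ℝ) ≤ mm - em)] at e5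
  rw [abs_of_nonneg hmm0, abs_of_nonneg hem0, abs_of_nonneg (by linarith : (0:ℝ) ≤ mm - em)] at e6
  have t1 : |entB ((a + ep : ℕ) : ℝ) ((g + ep : ℕ) : ℝ) - entB (a : ℝ) g| ≤ 2 * mm * (1 + Real.log N) :=
    le_trans e1 (mul_le_mul_of_nonneg_right (by linarith) hL)
  have t2 : |entB ((N - (a + ep) : ℕ) : ℝ) ((a + ep - (g + ep) : ℕ) : ℝ) - entB ((n - a : ℕ) : ℝ) ((a - g : ℕ) : ℝ)| ≤
      2 * mm * (1 + Real.log N) := le_trans e2 (mul_le_mul_of_nonneg_right (by linarith) hL)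
  have t3 : |entB (N : ℝ) ((a + ep : ℕ) : ℝ) - entB (n : ℝ) a| ≤ 3 * mm * (1 + Real.log N) :=
    le_trans e3 (mul_le_mul_of_nonneg_right (by linarith) hL)
  have t4 : |entB ((b + em : ℕ) : ℝ) ((h + em : ℕ) : ℝ) - entB (b : ℝ) h| ≤ 2 * mm * (1 + Real.log N) :=
    le_trans e4 (mul_le_mul_of_nonneg_right (by linarith) hL)
  have t5 : |entB ((N - (b + em) : ℕ) : ℝ) ((b + em - (h + em) : ℕ) : ℝ) - entB ((n - b : ℕ) : ℝ) ((b - h : ℕ) : ℝ)| ≤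
      2 * mm * (1 + Real.log N) := le_trans e5 (mul_le_mul_of_nonneg_right (by linarith) hL)
  have t6 : |entB (N : ℝ) ((b + em : ℕ) : ℝ) - entB (n : ℝ) b| ≤ 3 * mm * (1 + Real.log N) :=
    le_trans e6 (mul_le_mul_of_nonneg_right (by linarith) hL)
  rw [abs_le] at t1 t2 t3 t4 t5 t6 ⊢
  constructor <;> linarith [t1.1, t1.2, t2.1, t2.2, t3.1, t3.2, t4.1, t4.2, t5.1, t5.2, t6.1, t6.2]

variable {α β α' β' : ℝ}

set_option maxHeartbeats 1600000 in
/-- **A far term of the general outer sum**: if every non-degenerate inner term of the big colour and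
of the small colour has `(q+1)`-scaled rate at most `-X - n f_A(g,h)`, then
`A(g,h) ρ'^q ρ ≤ (N+1)^q (n+1) exp(5q(log N/2+2) + 7(log n/2+2) - X)`. [cite: Sly2010, §3.3] -/
theorem slyFarTermGen_le (q : ℕ) {n N a b a' b' g h g' h' : ℕ} (hn : 1 ≤ n) (hN : 1 ≤ N)
    (hga : g ≤ a) (hhb : h ≤ b) (hbN : b + b - h ≤ n) (habN : a + b < n)
    (hga' : g' ≤ a') (hhb' : h' ≤ b') (hbN' : b' + b' - h' ≤ N) (habN' : a' + b' < N)
    (hPP : a' - g' = a - g) {X : ℝ}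
    (hGbig : ∀ e : ℕ, e ≤ a' - g' → slyB0 N a' b' g' h' * slyT N a' b' g' h' e ≠ 0 →
      ((q : ℝ) + 1) * (N * slyGrate ((a' : ℝ) / N) ((b' : ℝ) / N) ((g' : ℝ) / N) ((h' : ℝ) / N) ((e : ℝ) / N)) ≤
        -X - n * slyFA ((a : ℝ) / n) ((b : ℝ) / n) ((g : ℝ) / n) ((h : ℝ) / n))
    (hGsmall : ∀ e : ℕ, e ≤ a - g → slyB0 n a b g h * slyT n a b g h e ≠ 0 →
      ((q : ℝ) + 1) * (n * slyGrate ((a : ℝ) / n) ((b : ℝ) / n) ((g : ℝ) / n) ((h : ℝ) / n) ((e : ℝ) / n)) ≤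
        -X - n * slyFA ((a : ℝ) / n) ((b : ℝ) / n) ((g : ℝ) / n) ((h : ℝ) / n)) :
    slyAcoef n a b g h * slyRho N a' b' g' h' ^ q * slyRho n a b g h ≤
      ((N : ℝ) + 1) ^ q * ((n : ℝ) + 1) *
        Real.exp (5 * q * (Real.log N / 2 + 2) + 7 * (Real.log n / 2 + 2) - X) := by
  have hnR : (0 : ℝ) < n := by exact_mod_cast hn
  have hNR : (0 : ℝ) < N := by exact_mod_cast hN
  have hq1 : (0 : ℝ) < (q : ℝ) + 1 := by positivity
  set fA := slyFA ((a : ℝ) / n) ((b : ℝ) / n) ((g : ℝ) / n) ((h : ℝ) / n) with hfA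
  set Ln := Real.log n / 2 + 2 with hLn
  set LN := Real.log N / 2 + 2 with hLN
  set Y : ℝ := (-X - n * fA) / ((q : ℝ) + 1) with hY
  -- big colour terms
  have hterm' : ∀ e ∈ range (a' - g' + 1), slyB0 N a' b' g' h' * slyT N a' b' g' h' e ≤
      Real.exp (Y + 5 * LN) := by
    intro e he
    rw [mem_range, Nat.lt_succ_iff] at he
    by_cases h0 : slyB0 N a' b' g' h' * slyT N a' b' g' h' e = 0
    · rw [h0]; exact (Real.exp_pos _).le
    refine le_trans (slyB0_mul_slyT_le hN hga' hhb' hbN' habN' he) ?_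
    rw [Real.exp_le_exp, hY, hLN]
    have := hGbig e he h0
    have : (N : ℝ) * slyGrate ((a' : ℝ) / N) ((b' : ℝ) / N) ((g' : ℝ) / N) ((h' : ℝ) / N) ((e : ℝ) / N) ≤
        (-X - n * fA) / ((q : ℝ) + 1) := by rw [le_div_iff₀ hq1]; linarith
    linarith
  have hρ' : slyRho N a' b' g' h' ≤ ((N : ℝ) + 1) * Real.exp (Y + 5 * LN) := by
    unfold slyRho
    refine le_trans (sum_le_sum hterm') ?_
    rw [sum_const, card_range, nsmul_eq_mul]
    apply mul_le_mul_of_nonneg_right _ (Real.exp_pos _).le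
    have : a' - g' + 1 ≤ N + 1 := by omega
    exact_mod_cast this
  -- small colour terms
  have hterm : ∀ e ∈ range (a - g + 1), slyB0 n a b g h * slyT n a b g h e ≤ Real.exp (Y + 5 * Ln) := by
    intro e he
    rw [mem_range, Nat.lt_succ_iff] at he
    by_cases h0 : slyB0 n a b g h * slyT n a b g h e = 0
    · rw [h0]; exact (Real.exp_pos _).le
    refine le_trans (slyB0_mul_slyT_le hn hga hhb hbN habN he) ?_
    rw [Real.exp_le_exp, hY, hLn]
    have := hGsmall e he h0
    have : (n : ℝ) * slyGrate ((a : ℝ) / n) ((b : ℝ) / n) ((g : ℝ) / n) ((h : ℝ) / n) ((e : ℝ) / n) ≤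
        (-X - n * fA) / ((q : ℝ) + 1) := by rw [le_div_iff₀ hq1]; linarith
    linarith
  have hρ : slyRho n a b g h ≤ ((n : ℝ) + 1) * Real.exp (Y + 5 * Ln) := by
    unfold slyRho
    refine le_trans (sum_le_sum hterm) ?_
    rw [sum_const, card_range, nsmul_eq_mul]
    apply mul_le_mul_of_nonneg_right _ (Real.exp_pos _).le
    have : a - g + 1 ≤ n + 1 := by omega
    exact_mod_cast this
  have hρ0 : 0 ≤ slyRho n a b g h := by
    unfold slyRho; exact sum_nonneg fun e _ => by unfold slyB0 slyT; positivity
  have hρ0' : 0 ≤ slyRho N a' b' g' h' := by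
    unfold slyRho; exact sum_nonneg fun e _ => by unfold slyB0 slyT; positivity
  have hA := slyAcoef_le hn hga hhb (by omega) (by omega)
  rw [← hfA, ← hLn] at hA
  have hA0 : 0 ≤ slyAcoef n a b g h := by unfold slyAcoef; positivity
  calc slyAcoef n a b g h * slyRho N a' b' g' h' ^ q * slyRho n a b g h
      ≤ Real.exp (n * fA + 2 * Ln) * (((N : ℝ) + 1) * Real.exp (Y + 5 * LN)) ^ q *
          (((n : ℝ) + 1) * Real.exp (Y + 5 * Ln)) :=
        mul_le_mul (mul_le_mul hA (pow_le_pow_left₀ hρ0' hρ' q) (by positivity) (by positivity)) hρ hρ0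
          (by positivity)
    _ = ((N : ℝ) + 1) ^ q * ((n : ℝ) + 1) *
          (Real.exp (n * fA + 2 * Ln) * Real.exp (Y + 5 * LN) ^ q * Real.exp (Y + 5 * Ln)) := by
        rw [mul_pow]; ring
    _ = ((N : ℝ) + 1) ^ q * ((n : ℝ) + 1) *
          Real.exp (5 * q * LN + 7 * Ln - X) := by
        congr 1
        rw [← Real.exp_nat_mul, ← Real.exp_add, ← Real.exp_add]
        congr 1
        rw [hY]
        field_simp
        ring

end FarGen

section ExplicitGen

variable {α β α' β' : ℝ}

/-- The boundary shift of the big colour's deviation from its product point is small: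
`|((g+ep)/N - α'²) - (g - nα²)/N| ≤ 5 m'/N` (with `a = nα`, `a + ep = Nα'`, `N = n + m'`).
[folklore] -/
theorem abs_big_dev_sub_le {n N mm a ep g : ℕ} (hn : 0 < n) (hNn : N = n + mm) (hep : ep ≤ mm)
    (hmmn : mm ≤ n) (han : a ≤ n) (hα : (a : ℝ) = n * α) (hα' : ((a + ep : ℕ) : ℝ) = N * α') :
    |(((g + ep : ℕ) : ℝ) / N - α' ^ 2) - ((g : ℝ) - n * α ^ 2) / N| ≤ 5 * mm / N := by
  have hN : 0 < N := by omega
  have hnR : (0 : ℝ) < n := by exact_mod_cast hn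
  have hNR : (0 : ℝ) < N := by exact_mod_cast hN
  have hmmR : (mm : ℝ) ≤ n := by exact_mod_cast hmmn
  have hepR : (ep : ℝ) ≤ mm := by exact_mod_cast hep
  have haR : (a : ℝ) ≤ n := by exact_mod_cast han
  have hep0 : (0 : ℝ) ≤ ep := Nat.cast_nonneg ep
  have ha0 : (0 : ℝ) ≤ a := Nat.cast_nonneg a
  have hmm0 : (0 : ℝ) ≤ mm := Nat.cast_nonneg mm
  -- `α = a/n`, `α' = (a+ep)/N`
  have eα : α = a / n := by rw [hα]; field_simp
  have eα' : α' = ((a : ℝ) + ep) / N := by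
    have : ((a + ep : ℕ) : ℝ) = (a : ℝ) + ep := by push_cast; ring
    rw [this] at hα'; rw [hα']; field_simp
  have hNe : (N : ℝ) = n + mm := by rw [hNn]; push_cast; ring
  rw [eα, eα']
  push_cast
  rw [show ((g : ℝ) + ep) / N - (((a : ℝ) + ep) / N) ^ 2 - ((g : ℝ) - n * ((a : ℝ) / n) ^ 2) / N =
    (ep + (a : ℝ) ^ 2 / n - ((a : ℝ) + ep) ^ 2 / N) / N by field_simp; ring]
  rw [abs_div, abs_of_pos hNR]
  apply div_le_div_of_nonneg_right _ hNR.le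
  -- `|ep + a²/n - (a+ep)²/N| ≤ 5 mm`
  have key : (a : ℝ) ^ 2 / n - ((a : ℝ) + ep) ^ 2 / N =
      ((a : ℝ) ^ 2 * mm - 2 * n * a * ep - n * ep ^ 2) / (n * N) := by
    rw [hNe]; field_simp; ring
  rw [show (ep : ℝ) + (a : ℝ) ^ 2 / n - ((a : ℝ) + ep) ^ 2 / N =
    ep + ((a : ℝ) ^ 2 / n - ((a : ℝ) + ep) ^ 2 / N) by ring, key, abs_le]
  have hnN : (0 : ℝ) < n * N := by positivity
  constructor
  · -- lower bound: the fraction is ≥ -(2 n a ep + n ep²)/(nN) ≥ -3 mm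
    have h1 : -(3 * (mm : ℝ)) ≤ ((a : ℝ) ^ 2 * mm - 2 * n * a * ep - n * ep ^ 2) / (n * N) := by
      rw [le_div_iff₀ hnN, hNe]
      nlinarith [mul_nonneg ha0 hep0, mul_nonneg hmm0 (sq_nonneg (a:ℝ)), mul_nonneg hnR.le hep0,
        mul_le_mul haR hepR hep0 hnR.le, mul_le_mul hepR hepR hep0 hmm0,
        mul_nonneg hnR.le (mul_nonneg hmm0 hmm0), mul_nonneg hmm0 (mul_nonneg hmm0 hmm0)]
    linarith
  · have h1 : ((a : ℝ) ^ 2 * mm - 2 * n * a * ep - n * ep ^ 2) / (n * N) ≤ mm := by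
      rw [div_le_iff₀ hnN, hNe]
      nlinarith [mul_nonneg ha0 hep0, mul_le_mul haR haR ha0 hnR.le, mul_nonneg hnR.le hep0,
        mul_nonneg hnR.le (mul_nonneg hmm0 hmm0), mul_nonneg hmm0 (sq_nonneg (a:ℝ)),
        mul_le_mul_of_nonneg_right (mul_le_mul haR haR ha0 hnR.le) hmm0]
    linarith

set_option maxHeartbeats 3200000 in
/-- **A near term of the general outer sum, Gaussian form**: for `(g,h)` in the small colour's
window, `A ρ'^q ρ ≤ e^{-(A_t x₁² + 2B_t x₁x₂ + C_t x₂²)/(2n)} · Const · Err · e^{Ξ}` with the combined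
planar form, `Const = (2πn)⁻¹ e^{Pref_A/2} KB'^q KB`, and the boundary-shift slack
`Ξ = 120 q K' c₀ w m'`. [cite: Sly2010, Lemma 3.5] -/
theorem slyNearGen_gauss_le (q : ℕ) {n N mm a b ep em g h μ μ' : ℕ} {m m' κ η η' r₀ w c₀ : ℝ}
    {α β α' β' : ℝ}
    (hn : 1 ≤ n) (hNn : N = n + mm) (hep : ep ≤ mm) (hem : em ≤ mm) (hmmn : mm ≤ n)
    (hga : g ≤ a) (hhb : h ≤ b) (hb2 : b + b ≤ n) (habN : a + b < n) (hb2' : (b + em) + (b + em) ≤ N)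
    (habN' : (a + ep) + (b + em) < N)
    (hα : (a : ℝ) = n * α) (hβ : (b : ℝ) = n * β) (hα0 : 0 < α) (hβ0 : 0 < β) (hαβ : α + β < 1)
    (hα' : ((a + ep : ℕ) : ℝ) = N * α') (hβ' : ((b + em : ℕ) : ℝ) = N * β') (hα0' : 0 < α')
    (hβ0' : 0 < β') (hαβ' : α' + β' < 1)
    (hm : m = min (min α β) (1 - α - β)) (hm' : m' = min (min α' β') (1 - α' - β'))
    (hκ : 0 < κ) (hw : 0 < w) (hc₀ : 0 < c₀) (hc₀1 : 2 * c₀ ≤ 1)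
    (hPD : ∀ h₁ h₂ h₃ : ℝ, slyQ (q + 1) α β h₁ h₂ h₃ ≤ -κ * (h₁ ^ 2 + h₂ ^ 2 + h₃ ^ 2))
    (hPD' : ∀ h₁ h₂ h₃ : ℝ, slyQ (q + 1) α' β' h₁ h₂ h₃ ≤ -κ * (h₁ ^ 2 + h₂ ^ 2 + h₃ ^ 2))
    (hgap : ∀ c ∈ slyPolytope α β, r₀ ≤ dist c (slyCstar α β) →
      slyRate (q + 1) α β c.1 c.2.1 c.2.2 ≤ -η)
    (hgap' : ∀ c ∈ slyPolytope α' β', r₀ ≤ dist c (slyCstar α' β') →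
      slyRate (q + 1) α' β' c.1 c.2.1 c.2.2 ≤ -η')
    (hr₀ : 3 * r₀ ≤ m ^ 2 / 2) (hr₀m' : 3 * r₀ ≤ m' ^ 2 / 2)
    (hr₀κ : 12 * (4 + 7 * ((q + 1 : ℕ) : ℝ)) * (8 * r₀) ≤ κ / 4 * m ^ 4)
    (hr₀κm' : 12 * (4 + 7 * ((q + 1 : ℕ) : ℝ)) * (8 * r₀) ≤ κ / 4 * m' ^ 4)
    (hQ : 3 * (((q + 1 : ℕ) : ℝ) + 2) / m ^ 5 * c₀ ^ 2 ≤ κ / 8)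
    (hQ' : 3 * (((q + 1 : ℕ) : ℝ) + 2) / m' ^ 5 * (2 * c₀) ^ 2 ≤ κ / 8)
    (hcube : 48 * c₀ ^ 3 * w ≤ κ / 8 * m ^ 4) (hcube' : 48 * (2 * c₀) ^ 3 * w ≤ κ / 8 * m' ^ 4)
    (hηw : κ * w ^ 2 ≤ η) (hηw' : κ * w ^ 2 ≤ η') (hw2 : 2 * w ≤ m ^ 2 / 4) (hw2' : 2 * w ≤ m' ^ 2 / 4)
    (hμ1 : 1 ≤ μ) (hμ : (μ : ℝ) ≤ n * (m ^ 2 / 2)) (hμ1' : 1 ≤ μ') (hμ' : (μ' : ℝ) ≤ N * (m' ^ 2 / 2))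
    (hshift : 40 * (mm : ℝ) ≤ c₀ * w * N)
    (hnear : |(g : ℝ) / n - α ^ 2| + |(h : ℝ) / n - β ^ 2| ≤ c₀ * w) :
    slyAcoef n a b g h * slyRho N (a + ep) (b + em) (g + ep) (h + em) ^ q * slyRho n a b g h ≤
      Real.exp (-((slySAgen q ((n : ℝ) / N) α β α' β' * ((g : ℝ) - n * α ^ 2) ^ 2 +
          2 * slySBgen q ((n : ℝ) / N) α β α' β' * ((g : ℝ) - n * α ^ 2) * ((h : ℝ) - n * β ^ 2) +
          slySCgen q ((n : ℝ) / N) α β α' β' * ((h : ℝ) - n * β ^ 2) ^ 2) / (2 * n))) *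
        ((2 * π * n)⁻¹ * Real.exp (slyPrefA α β (α ^ 2) (β ^ 2) / 2) *
          (Real.exp (slyPrefB α' β' (α' ^ 2) (β' ^ 2) (α' * (1 - α' - β')) / 2) / Real.sqrt (slyK3 α' β')) ^ q *
          (Real.exp (slyPrefB α β (α ^ 2) (β ^ 2) (α * (1 - α - β)) / 2) / Real.sqrt (slyK3 α β))) *
        (Real.exp (48 * n * (c₀ * w) ^ 3 / m ^ 4 + 8 * (c₀ * w) / (m ^ 2 / 2) / 2 + 2 / (μ : ℝ)) *
          (Real.exp (180 * N * (2 * w) ^ 3 / m' ^ 4 + 19 * (2 * w) / (2 * (m' ^ 2 / 2)) + 11 / (6 * (μ' : ℝ))) *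
              (1 + 2 / (rexp (π ^ 2 / (slyK3 α' β' / (2 * N))) - 1)) +
            ((N : ℝ) + 1) * Real.exp (-(N * κ * w ^ 2 / (2 * (q + 1 : ℕ))) + 5 * (Real.log N / 2 + 2)) /
              (Real.exp (slyPrefB α' β' (α' ^ 2) (β' ^ 2) (α' * (1 - α' - β')) / 2) / Real.sqrt (slyK3 α' β'))) ^ q *
          (Real.exp (180 * n * (2 * w) ^ 3 / m ^ 4 + 19 * (2 * w) / (2 * (m ^ 2 / 2)) + 11 / (6 * (μ : ℝ))) *
              (1 + 2 / (rexp (π ^ 2 / (slyK3 α β / (2 * n))) - 1)) +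
            ((n : ℝ) + 1) * Real.exp (-(n * κ * w ^ 2 / (2 * (q + 1 : ℕ))) + 5 * (Real.log n / 2 + 2)) /
              (Real.exp (slyPrefB α β (α ^ 2) (β ^ 2) (α * (1 - α - β)) / 2) / Real.sqrt (slyK3 α β)))) *
        Real.exp (120 * q * (3 * (((q + 1 : ℕ) : ℝ) + 2) / m' ^ 5 + 6 / m' ^ 5) * c₀ * w * mm) := by
  have hd : 1 ≤ q + 1 := by omega
  have hn0 : 0 < n := hn
  have hN1 : 1 ≤ N := by omega
  have hN0 : 0 < N := by omega
  have hnR : (0 : ℝ) < n := by exact_mod_cast hn0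
  have hNR : (0 : ℝ) < N := by exact_mod_cast hN0
  have hnN : (n : ℝ) ≤ N := by exact_mod_cast (show n ≤ N by omega)
  have han : a ≤ n := by omega
  have hbn : b ≤ n := by omega
  have hc₀1' : c₀ ≤ 1 := by linarith
  have hshift' : 10 * (mm : ℝ) / N ≤ c₀ * w / 4 := by
    rw [div_le_iff₀ hNR]; linarith
  have hnN1 : (n : ℝ) / N ≤ 1 := by rw [div_le_one hNR]; exact hnN
  have hbN : b + b - h ≤ n := by omega
  have hbN' : (b + em) + (b + em) - (h + em) ≤ N := by omega
  set K' : ℝ := 3 * (((q + 1 : ℕ) : ℝ) + 2) / m' ^ 5 + 6 / m' ^ 5 with hK'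
  have hm0' : 0 < m' := by rw [hm']; exact lt_min (lt_min hα0' hβ0') (by linarith)
  have hK'0 : 0 ≤ K' := by positivity
  -- deviations of the big colour
  have hd1 := abs_big_dev_sub_le (g := g) hn0 hNn hep hmmn han hα hα'
  have hd2 := abs_big_dev_sub_le (g := h) hn0 hNn hem hmmn hbn hβ hβ'
  set x₁ := (g : ℝ) - n * α ^ 2 with hx₁
  set x₂ := (h : ℝ) - n * β ^ 2 with hx₂
  have ex1 : (g : ℝ) / n - α ^ 2 = x₁ / n := by rw [hx₁]; field_simp
  have ex2 : (h : ℝ) / n - β ^ 2 = x₂ / n := by rw [hx₂]; field_simp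
  have hxx : |x₁ / N| + |x₂ / N| ≤ c₀ * w := by
    have e1 : x₁ / N = (n / N) * (x₁ / n) := by field_simp
    have e2 : x₂ / N = (n / N) * (x₂ / n) := by field_simp
    rw [e1, e2, abs_mul, abs_mul, abs_of_pos (by positivity : (0:ℝ) < n / N), ← mul_add, ← ex1, ← ex2]
    calc (n : ℝ) / N * (|(g : ℝ) / n - α ^ 2| + |(h : ℝ) / n - β ^ 2|) ≤ 1 * (c₀ * w) :=
          mul_le_mul hnN1 hnear (by positivity) (by norm_num)
      _ = c₀ * w := one_mul _
  set y₁ := ((g + ep : ℕ) : ℝ) / N - α' ^ 2 with hy₁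
  set y₂ := ((h + em : ℕ) : ℝ) / N - β' ^ 2 with hy₂
  have t1 : |y₁| ≤ |x₁ / N| + 5 * mm / N := by
    have := abs_add_le (x₁ / N) (y₁ - x₁ / N)
    rw [add_sub_cancel] at this; linarith
  have t2 : |y₂| ≤ |x₂ / N| + 5 * mm / N := by
    have := abs_add_le (x₂ / N) (y₂ - x₂ / N)
    rw [add_sub_cancel] at this; linarith
  have h10 : 10 * (mm : ℝ) / N = 5 * mm / N + 5 * mm / N := by ring
  have hnear' : |y₁| + |y₂| ≤ 2 * c₀ * w := by
    have hcw : 0 < c₀ * w := mul_pos hc₀ hw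
    linarith
  have hNT := slyNearTermGen_le q hn hN1 hga hhb hbN habN hbN' habN' hα hβ hα0 hβ0 hαβ hα' hβ' hα0'
    hβ0' hαβ' hm hm' hκ hw hc₀1' hc₀1 hPD hPD' hgap hgap' hr₀ hr₀m' hr₀κ hr₀κm' hQ
    (by simpa [mul_pow] using hQ') hcube (by simpa [mul_pow] using hcube') hηw hηw' hw2 hw2' hμ1 hμ hμ1'
    hμ' hnear (by rw [← hy₁, ← hy₂]; linarith [hnear'])
  rw [← hy₁, ← hy₂] at hNT
  -- replace the big colour's deviation by `x/N`
  have hMBshift : (N : ℝ) * slyMB α' β' y₁ y₂ ≤ N * slyMB α' β' (x₁ / N) (x₂ / N) + 120 * K' * c₀ * w * mm := by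
    have hsub := abs_slyMB_sub_le hd hα0' hβ0' hαβ' hm' hκ hPD' y₁ y₂ (x₁ / N) (x₂ / N)
    rw [← hK'] at hsub
    have hA1 : |y₁| + |y₂| + |x₁ / N| + |x₂ / N| ≤ 3 * (c₀ * w) := by linarith
    have hA2 : |y₁ - x₁ / N| + |y₂ - x₂ / N| ≤ 10 * mm / N := by linarith
    have hprod : 4 * K' * (|y₁| + |y₂| + |x₁ / N| + |x₂ / N|) * (|y₁ - x₁ / N| + |y₂ - x₂ / N|) ≤
        4 * K' * (3 * (c₀ * w)) * (10 * mm / N) :=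
      mul_le_mul (mul_le_mul_of_nonneg_left hA1 (by positivity)) hA2 (by positivity) (by positivity)
    have habs := le_trans hsub hprod
    rw [abs_le] at habs
    have e : (N : ℝ) * (4 * K' * (3 * (c₀ * w)) * (10 * mm / N)) = 120 * K' * c₀ * w * mm := by
      field_simp
      ring
    have h3 := mul_le_mul_of_nonneg_left habs.2 hNR.le
    rw [mul_sub, e] at h3
    linarith
  -- the exponent in lattice coordinates
  have hlat := slyGen_lattice (q := q) (α := α) (β := β) (α' := α') (β' := β') hn0 hN0 hα0 hβ0 hαβ x₁ x₂
  have hq0 : (0 : ℝ) ≤ q := Nat.cast_nonneg q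
  have hqM := mul_le_mul_of_nonneg_left hMBshift hq0
  have eΞ : (q : ℝ) * (N * slyMB α' β' (x₁ / N) (x₂ / N) + 120 * K' * c₀ * w * mm) =
      q * (N * slyMB α' β' (x₁ / N) (x₂ / N)) + 120 * q * K' * c₀ * w * mm := by ring
  rw [eΞ] at hqM
  have hexp : Real.exp (n * slyQ 0 α β ((g : ℝ) / n - α ^ 2) ((h : ℝ) / n - β ^ 2) 0 +
      n * slyMB α β ((g : ℝ) / n - α ^ 2) ((h : ℝ) / n - β ^ 2) + q * (N * slyMB α' β' y₁ y₂)) ≤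
      Real.exp (-((slySAgen q ((n : ℝ) / N) α β α' β' * x₁ ^ 2 +
          2 * slySBgen q ((n : ℝ) / N) α β α' β' * x₁ * x₂ +
          slySCgen q ((n : ℝ) / N) α β α' β' * x₂ ^ 2) / (2 * n))) * Real.exp (120 * q * K' * c₀ * w * mm) := by
    rw [← Real.exp_add, Real.exp_le_exp, ex1, ex2, ← hlat]
    linarith
  refine le_trans hNT ?_
  have hrest : 0 ≤ ((2 * π * n)⁻¹ * Real.exp (slyPrefA α β (α ^ 2) (β ^ 2) / 2) *
      (Real.exp (slyPrefB α' β' (α' ^ 2) (β' ^ 2) (α' * (1 - α' - β')) / 2) / Real.sqrt (slyK3 α' β')) ^ q *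
      (Real.exp (slyPrefB α β (α ^ 2) (β ^ 2) (α * (1 - α - β)) / 2) / Real.sqrt (slyK3 α β))) := by positivity
  have hκ3 := slyK3_pos hα0 hβ0 hαβ
  have hκ3' := slyK3_pos hα0' hβ0' hαβ'
  have h1τ : 1 ≤ 1 + 2 / (rexp (π ^ 2 / (slyK3 α β / (2 * n))) - 1) := one_le_thetaFactor (by positivity)
  have h1τ' : 1 ≤ 1 + 2 / (rexp (π ^ 2 / (slyK3 α' β' / (2 * N))) - 1) := one_le_thetaFactor (by positivity)
  have herr : 0 ≤ Real.exp (48 * n * (c₀ * w) ^ 3 / m ^ 4 + 8 * (c₀ * w) / (m ^ 2 / 2) / 2 + 2 / (μ : ℝ)) *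
      (Real.exp (180 * N * (2 * w) ^ 3 / m' ^ 4 + 19 * (2 * w) / (2 * (m' ^ 2 / 2)) + 11 / (6 * (μ' : ℝ))) *
          (1 + 2 / (rexp (π ^ 2 / (slyK3 α' β' / (2 * N))) - 1)) +
        ((N : ℝ) + 1) * Real.exp (-(N * κ * w ^ 2 / (2 * (q + 1 : ℕ))) + 5 * (Real.log N / 2 + 2)) /
          (Real.exp (slyPrefB α' β' (α' ^ 2) (β' ^ 2) (α' * (1 - α' - β')) / 2) / Real.sqrt (slyK3 α' β'))) ^ q *
      (Real.exp (180 * n * (2 * w) ^ 3 / m ^ 4 + 19 * (2 * w) / (2 * (m ^ 2 / 2)) + 11 / (6 * (μ : ℝ))) *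
          (1 + 2 / (rexp (π ^ 2 / (slyK3 α β / (2 * n))) - 1)) +
        ((n : ℝ) + 1) * Real.exp (-(n * κ * w ^ 2 / (2 * (q + 1 : ℕ))) + 5 * (Real.log n / 2 + 2)) /
          (Real.exp (slyPrefB α β (α ^ 2) (β ^ 2) (α * (1 - α - β)) / 2) / Real.sqrt (slyK3 α β))) := by
    positivity
  calc _ ≤ (Real.exp (-((slySAgen q ((n : ℝ) / N) α β α' β' * x₁ ^ 2 +
          2 * slySBgen q ((n : ℝ) / N) α β α' β' * x₁ * x₂ +
          slySCgen q ((n : ℝ) / N) α β α' β' * x₂ ^ 2) / (2 * n))) * Real.exp (120 * q * K' * c₀ * w * mm)) * _ * _ :=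
        mul_le_mul_of_nonneg_right (mul_le_mul_of_nonneg_right hexp hrest) herr
    _ = _ := by ring

set_option maxHeartbeats 3200000 in
/-- **A far term of the general outer sum, discharged**: for `(g,h)` outside the small colour's
window both colours' non-degenerate inner terms are in the far cone, and the overlap-rate shift is
at most `14 m'(1 + log N)`. [cite: Sly2010, §3.3] -/
theorem slyFarGen_le (q : ℕ) {n N mm a b ep em g h : ℕ} {m m' κ η η' r₀ w c₀ : ℝ} {α β α' β' : ℝ}
    (hn : 1 ≤ n) (hNn : N = n + mm) (hep : ep ≤ mm) (hem : em ≤ mm) (hmmn : mm ≤ n)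
    (hga : g ≤ a) (hhb : h ≤ b) (hb2 : b + b ≤ n) (habN : a + b < n) (hb2' : (b + em) + (b + em) ≤ N)
    (habN' : (a + ep) + (b + em) < N)
    (hα : (a : ℝ) = n * α) (hβ : (b : ℝ) = n * β) (hα0 : 0 < α) (hβ0 : 0 < β) (hαβ : α + β < 1)
    (hα' : ((a + ep : ℕ) : ℝ) = N * α') (hβ' : ((b + em : ℕ) : ℝ) = N * β') (hα0' : 0 < α')
    (hβ0' : 0 < β') (hαβ' : α' + β' < 1)
    (hm : m = min (min α β) (1 - α - β)) (hm' : m' = min (min α' β') (1 - α' - β'))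
    (hκ : 0 < κ) (hw : 0 < w) (hc₀ : 0 < c₀) (hc₀1 : 2 * c₀ ≤ 1)
    (hPD : ∀ h₁ h₂ h₃ : ℝ, slyQ (q + 1) α β h₁ h₂ h₃ ≤ -κ * (h₁ ^ 2 + h₂ ^ 2 + h₃ ^ 2))
    (hPD' : ∀ h₁ h₂ h₃ : ℝ, slyQ (q + 1) α' β' h₁ h₂ h₃ ≤ -κ * (h₁ ^ 2 + h₂ ^ 2 + h₃ ^ 2))
    (hgap : ∀ c ∈ slyPolytope α β, r₀ ≤ dist c (slyCstar α β) →
      slyRate (q + 1) α β c.1 c.2.1 c.2.2 ≤ -η)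
    (hgap' : ∀ c ∈ slyPolytope α' β', r₀ ≤ dist c (slyCstar α' β') →
      slyRate (q + 1) α' β' c.1 c.2.1 c.2.2 ≤ -η')
    (hr₀ : 3 * r₀ ≤ m ^ 2 / 2) (hr₀m' : 3 * r₀ ≤ m' ^ 2 / 2)
    (hr₀c : 12 * (4 + 7 * ((q + 1 : ℕ) : ℝ)) * (27 * r₀) ≤ κ / 2 * m ^ 4)
    (hr₀cm' : 12 * (4 + 7 * ((q + 1 : ℕ) : ℝ)) * (27 * r₀) ≤ κ / 2 * m' ^ 4)
    (hηw : κ * w ^ 2 ≤ η) (hηw' : κ * w ^ 2 ≤ η')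
    (hshift : 40 * (mm : ℝ) ≤ c₀ * w * N)
    (hfar : c₀ * w < |(g : ℝ) / n - α ^ 2| + |(h : ℝ) / n - β ^ 2|) :
    slyAcoef n a b g h * slyRho N (a + ep) (b + em) (g + ep) (h + em) ^ q * slyRho n a b g h ≤
      ((N : ℝ) + 1) ^ q * ((n : ℝ) + 1) *
        Real.exp (5 * q * (Real.log N / 2 + 2) + 7 * (Real.log n / 2 + 2) -
          (n * (κ / 2 * (c₀ * w / 8) ^ 2) - 14 * mm * (1 + Real.log N))) := by
  have hn0 : 0 < n := hn
  have hN1 : 1 ≤ N := by omega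
  have hN0 : 0 < N := by omega
  have hnR : (0 : ℝ) < n := by exact_mod_cast hn0
  have hNR : (0 : ℝ) < N := by exact_mod_cast hN0
  have hnN : (n : ℝ) ≤ N := by exact_mod_cast (show n ≤ N by omega)
  have hNn2 : (N : ℝ) ≤ 2 * n := by
    have : N ≤ 2 * n := by omega
    exact_mod_cast this
  have han : a ≤ n := by omega
  have hbn : b ≤ n := by omega
  have eα : (a : ℝ) / n = α := by rw [hα]; field_simp
  have eβ : (b : ℝ) / n = β := by rw [hβ]; field_simp
  have eα' : ((a + ep : ℕ) : ℝ) / N = α' := by rw [hα']; field_simp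
  have eβ' : ((b + em : ℕ) : ℝ) / N = β' := by rw [hβ']; field_simp
  have hshift' : 10 * (mm : ℝ) / N ≤ c₀ * w / 4 := by
    rw [div_le_iff₀ hNR]; linarith
  have hnN2 : 1 / 2 ≤ (n : ℝ) / N := by rw [le_div_iff₀ hNR]; linarith
  have hbN : b + b - h ≤ n := by omega
  have hbN' : (b + em) + (b + em) - (h + em) ≤ N := by omega
  set X : ℝ := n * (κ / 2 * (c₀ * w / 8) ^ 2) - 14 * mm * (1 + Real.log N) with hX
  -- degenerate overlap factor
  by_cases hPn : a - g ≤ n - a ∧ b - h ≤ n - b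
  swap
  · have hz : slyAcoef n a b g h = 0 := by
      unfold slyAcoef
      rcases not_and_or.mp hPn with h2 | h3
      · have : ((n - a).choose (a - g) : ℝ) = 0 := by exact_mod_cast Nat.choose_eq_zero_of_lt (by omega)
        rw [this]; ring
      · have : ((n - b).choose (b - h) : ℝ) = 0 := by exact_mod_cast Nat.choose_eq_zero_of_lt (by omega)
        rw [this]; ring
    rw [hz, zero_mul, zero_mul]; positivity
  obtain ⟨hPn1, hPn2⟩ := hPn
  have hshiftA := abs_nfA_shift_le (ep := ep) (em := em) hn0 hNn hep hem hga hhb han hbn hPn1 hPn2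
  rw [abs_le] at hshiftA
  have hι₀ : 0 < c₀ * w / 8 := by positivity
  have hc2 : (c₀ * w / 8) ^ 2 ≤ w ^ 2 := by
    apply pow_le_pow_left₀ hι₀.le; nlinarith
  have hηι : κ / 2 * (c₀ * w / 8) ^ 2 ≤ η := by nlinarith
  have hηι' : κ / 2 * (c₀ * w / 8) ^ 2 ≤ η' := by nlinarith
  -- deviations of the big colour
  have hd1 := abs_big_dev_sub_le (g := g) hn0 hNn hep hmmn han hα hα'
  have hd2 := abs_big_dev_sub_le (g := h) hn0 hNn hem hmmn hbn hβ hβ'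
  set x₁ := (g : ℝ) - n * α ^ 2 with hx₁
  set x₂ := (h : ℝ) - n * β ^ 2 with hx₂
  have ex1 : (g : ℝ) / n - α ^ 2 = x₁ / n := by rw [hx₁]; field_simp
  have ex2 : (h : ℝ) / n - β ^ 2 = x₂ / n := by rw [hx₂]; field_simp
  set y₁ := ((g + ep : ℕ) : ℝ) / N - α' ^ 2 with hy₁
  set y₂ := ((h + em : ℕ) : ℝ) / N - β' ^ 2 with hy₂
  have hbig : c₀ * w / 4 ≤ |y₁| + |y₂| := by
    have t1 : |x₁ / N| ≤ |y₁| + 5 * mm / N := by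
      have := abs_add_le y₁ (x₁ / N - y₁)
      rw [add_sub_cancel, abs_sub_comm (x₁ / N) y₁] at this; linarith
    have t2 : |x₂ / N| ≤ |y₂| + 5 * mm / N := by
      have := abs_add_le y₂ (x₂ / N - y₂)
      rw [add_sub_cancel, abs_sub_comm (x₂ / N) y₂] at this; linarith
    have e1 : x₁ / N = (n / N) * (x₁ / n) := by field_simp
    have e2 : x₂ / N = (n / N) * (x₂ / n) := by field_simp
    have hsum : |x₁ / N| + |x₂ / N| = (n / N) * (|(g : ℝ) / n - α ^ 2| + |(h : ℝ) / n - β ^ 2|) := by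
      rw [e1, e2, abs_mul, abs_mul, abs_of_pos (by positivity : (0:ℝ) < n / N), ex1, ex2]; ring
    have t3 : (1 / 2 : ℝ) * (|(g : ℝ) / n - α ^ 2| + |(h : ℝ) / n - β ^ 2|) ≤
        (n / N) * (|(g : ℝ) / n - α ^ 2| + |(h : ℝ) / n - β ^ 2|) :=
      mul_le_mul_of_nonneg_right hnN2 (by positivity)
    have h10 : 10 * (mm : ℝ) / N = 5 * mm / N + 5 * mm / N := by ring
    linarith
  refine slyFarTermGen_le q hn hN1 hga hhb hbN habN (by omega : g + ep ≤ a + ep)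
    (by omega : h + em ≤ b + em) hbN' habN' (by omega) (fun e he hne => ?_) (fun e he hne => ?_)
  · -- big colour
    rw [eα', eβ', eα, eβ]
    have hB0 : slyB0 N (a + ep) (b + em) (g + ep) (h + em) ≠ 0 := left_ne_zero_of_mul hne
    have ht : slyT N (a + ep) (b + em) (g + ep) (h + em) e ≠ 0 := right_ne_zero_of_mul hne
    have hgF : g + ep ≤ N - ((b + em) + (b + em) - (h + em)) := by
      by_contra hc
      push Not at hc
      apply hB0
      have : ((N - ((b + em) + (b + em) - (h + em))).choose (g + ep) : ℝ) = 0 := by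
        exact_mod_cast Nat.choose_eq_zero_of_lt hc
      unfold slyB0; rw [this]; ring
    have hpoly := mem_slyPolytope_of_slyT_ne_zero hN0 (by omega : g + ep ≤ a + ep)
      (by omega : h + em ≤ b + em) hbN' hgF he ht
    rw [eα', eβ'] at hpoly
    have hdist : c₀ * w / 8 ≤ dist ((((g + ep : ℕ) : ℝ) / N, ((h + em : ℕ) : ℝ) / N, (e : ℝ) / N) : ℝ × ℝ × ℝ)
        (slyCstar α' β') := by
      rw [slyCstar, Prod.dist_eq, Prod.dist_eq, Real.dist_eq, Real.dist_eq, Real.dist_eq, ← hy₁, ← hy₂]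
      have g1 := le_max_left |y₁| (max |y₂| |(e : ℝ) / N - α' * (1 - α' - β')|)
      have g2 := le_trans (le_max_left |y₂| |(e : ℝ) / N - α' * (1 - α' - β')|)
        (le_max_right |y₁| (max |y₂| |(e : ℝ) / N - α' * (1 - α' - β')|))
      linarith
    have hrate := slyRate_far_le (q + 1) hα0' hβ0' hαβ' hm' hκ hι₀ hPD' hgap' hr₀m' hr₀cm' hηι' hpoly hdist
    rw [slyRate_eq_zero_add _ _ _ _ _ (q + 1), slyRate_zero_eq_slyFA, Nat.cast_succ] at hrate
    rw [← eα', ← eβ'] at hrate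
    have hfA' := hshiftA.1
    rw [eα, eβ] at hfA'
    have hNι : (n : ℝ) * (κ / 2 * (c₀ * w / 8) ^ 2) ≤ N * (κ / 2 * (c₀ * w / 8) ^ 2) :=
      mul_le_mul_of_nonneg_right hnN (by positivity)
    have h2 := mul_le_mul_of_nonneg_left hrate hNR.le
    rw [mul_add] at h2
    have e1 : ((q : ℝ) + 1) * (N * slyGrate (((a + ep : ℕ) : ℝ) / N) (((b + em : ℕ) : ℝ) / N)
        (((g + ep : ℕ) : ℝ) / N) (((h + em : ℕ) : ℝ) / N) ((e : ℝ) / N)) =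
        N * (((q : ℝ) + 1) * slyGrate (((a + ep : ℕ) : ℝ) / N) (((b + em : ℕ) : ℝ) / N)
        (((g + ep : ℕ) : ℝ) / N) (((h + em : ℕ) : ℝ) / N) ((e : ℝ) / N)) := by ring
    rw [eα', eβ'] at e1 hfA' h2
    rw [e1, hX]
    have e2 : (N : ℝ) * (-(κ / 2) * (c₀ * w / 8) ^ 2) = -(N * (κ / 2 * (c₀ * w / 8) ^ 2)) := by ring
    rw [e2] at h2
    linarith
  · -- small colour
    rw [eα, eβ]
    have hB0 : slyB0 n a b g h ≠ 0 := left_ne_zero_of_mul hne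
    have ht : slyT n a b g h e ≠ 0 := right_ne_zero_of_mul hne
    have hgF : g ≤ n - (b + b - h) := by
      by_contra hc
      push Not at hc
      apply hB0
      have : ((n - (b + b - h)).choose g : ℝ) = 0 := by exact_mod_cast Nat.choose_eq_zero_of_lt hc
      unfold slyB0; rw [this]; ring
    have hpoly := mem_slyPolytope_of_slyT_ne_zero hn0 hga hhb hbN hgF he ht
    rw [eα, eβ] at hpoly
    have hdist : c₀ * w / 8 ≤ dist ((((g : ℝ) / n), ((h : ℝ) / n), ((e : ℝ) / n)) : ℝ × ℝ × ℝ) (slyCstar α β) := by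
      rw [slyCstar, Prod.dist_eq, Prod.dist_eq, Real.dist_eq, Real.dist_eq, Real.dist_eq]
      have g1 := le_max_left |(g : ℝ) / n - α ^ 2| (max |(h : ℝ) / n - β ^ 2| |(e : ℝ) / n - α * (1 - α - β)|)
      have g2 := le_trans (le_max_left |(h : ℝ) / n - β ^ 2| |(e : ℝ) / n - α * (1 - α - β)|)
        (le_max_right |(g : ℝ) / n - α ^ 2| (max |(h : ℝ) / n - β ^ 2| |(e : ℝ) / n - α * (1 - α - β)|))
      have hcw : 0 < c₀ * w := mul_pos hc₀ hw
      linarith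
    have hrate := slyRate_far_le (q + 1) hα0 hβ0 hαβ hm hκ hι₀ hPD hgap hr₀ hr₀c hηι hpoly hdist
    rw [slyRate_eq_zero_add _ _ _ _ _ (q + 1), slyRate_zero_eq_slyFA, Nat.cast_succ] at hrate
    rw [hX]
    have hL : 0 ≤ 14 * (mm : ℝ) * (1 + Real.log N) := by
      have : (1:ℝ) ≤ N := by exact_mod_cast hN1
      have := Real.log_nonneg this
      positivity
    have h2 := mul_le_mul_of_nonneg_left hrate hnR.le
    rw [mul_add] at h2
    have e1 : ((q : ℝ) + 1) * (n * slyGrate α β ((g : ℝ) / n) ((h : ℝ) / n) ((e : ℝ) / n)) =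
        n * (((q : ℝ) + 1) * slyGrate α β ((g : ℝ) / n) ((h : ℝ) / n) ((e : ℝ) / n)) := by ring
    have e2 : (n : ℝ) * (-(κ / 2) * (c₀ * w / 8) ^ 2) = -(n * (κ / 2 * (c₀ * w / 8) ^ 2)) := by ring
    rw [e2] at h2
    rw [e1]
    linarith

set_option maxHeartbeats 3200000 in
/-- **The second-moment ratio of `Z_{a,b}(η)`, explicit form**: near terms by the Gaussian form of
the general near term and the two-dimensional Gaussian lattice bound for the combined planar form;
far terms by the cone bounds of both colours.
[cite: Sly2010, Lemma 3.5 and §3.3; MosselWeitzWormald2008, proof of Theorem 6.11] -/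
theorem slyRatioGen_le_explicit (q : ℕ) {n N mm a b ep em μ μ' : ℕ} {m m' κ η η' r₀ w c₀ : ℝ}
    {α β α' β' : ℝ}
    (hn : 1 ≤ n) (hNn : N = n + mm) (hep : ep ≤ mm) (hem : em ≤ mm) (hmmn : mm ≤ n)
    (hb2 : b + b ≤ n) (habN : a + b < n) (hb2' : (b + em) + (b + em) ≤ N)
    (habN' : (a + ep) + (b + em) < N)
    (hα : (a : ℝ) = n * α) (hβ : (b : ℝ) = n * β) (hα0 : 0 < α) (hβ0 : 0 < β) (hαβ : α + β < 1)
    (hα' : ((a + ep : ℕ) : ℝ) = N * α') (hβ' : ((b + em : ℕ) : ℝ) = N * β') (hα0' : 0 < α')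
    (hβ0' : 0 < β') (hαβ' : α' + β' < 1)
    (hm : m = min (min α β) (1 - α - β)) (hm' : m' = min (min α' β') (1 - α' - β'))
    (hκ : 0 < κ) (hw : 0 < w) (hc₀ : 0 < c₀) (hc₀1 : 2 * c₀ ≤ 1)
    (hPD : ∀ h₁ h₂ h₃ : ℝ, slyQ (q + 1) α β h₁ h₂ h₃ ≤ -κ * (h₁ ^ 2 + h₂ ^ 2 + h₃ ^ 2))
    (hPD' : ∀ h₁ h₂ h₃ : ℝ, slyQ (q + 1) α' β' h₁ h₂ h₃ ≤ -κ * (h₁ ^ 2 + h₂ ^ 2 + h₃ ^ 2))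
    (hgap : ∀ c ∈ slyPolytope α β, r₀ ≤ dist c (slyCstar α β) →
      slyRate (q + 1) α β c.1 c.2.1 c.2.2 ≤ -η)
    (hgap' : ∀ c ∈ slyPolytope α' β', r₀ ≤ dist c (slyCstar α' β') →
      slyRate (q + 1) α' β' c.1 c.2.1 c.2.2 ≤ -η')
    (hr₀ : 3 * r₀ ≤ m ^ 2 / 2) (hr₀m' : 3 * r₀ ≤ m' ^ 2 / 2)
    (hr₀κ : 12 * (4 + 7 * ((q + 1 : ℕ) : ℝ)) * (8 * r₀) ≤ κ / 4 * m ^ 4)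
    (hr₀κm' : 12 * (4 + 7 * ((q + 1 : ℕ) : ℝ)) * (8 * r₀) ≤ κ / 4 * m' ^ 4)
    (hr₀c : 12 * (4 + 7 * ((q + 1 : ℕ) : ℝ)) * (27 * r₀) ≤ κ / 2 * m ^ 4)
    (hr₀cm' : 12 * (4 + 7 * ((q + 1 : ℕ) : ℝ)) * (27 * r₀) ≤ κ / 2 * m' ^ 4)
    (hQ : 3 * (((q + 1 : ℕ) : ℝ) + 2) / m ^ 5 * c₀ ^ 2 ≤ κ / 8)
    (hQ' : 3 * (((q + 1 : ℕ) : ℝ) + 2) / m' ^ 5 * (2 * c₀) ^ 2 ≤ κ / 8)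
    (hcube : 48 * c₀ ^ 3 * w ≤ κ / 8 * m ^ 4) (hcube' : 48 * (2 * c₀) ^ 3 * w ≤ κ / 8 * m' ^ 4)
    (hηw : κ * w ^ 2 ≤ η) (hηw' : κ * w ^ 2 ≤ η') (hw2 : 2 * w ≤ m ^ 2 / 4) (hw2' : 2 * w ≤ m' ^ 2 / 4)
    (hμ1 : 1 ≤ μ) (hμ : (μ : ℝ) ≤ n * (m ^ 2 / 2)) (hμ1' : 1 ≤ μ') (hμ' : (μ' : ℝ) ≤ N * (m' ^ 2 / 2))
    (hshift : 40 * (mm : ℝ) ≤ c₀ * w * N)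
    (hCt : 0 < slySCgen q ((n : ℝ) / N) α β α' β')
    (hDt : 0 < slySAgen q ((n : ℝ) / N) α β α' β' * slySCgen q ((n : ℝ) / N) α β α' β' -
      slySBgen q ((n : ℝ) / N) α β α' β' ^ 2) :
    slyRatioGen n N q a b ep em ≤
      (Real.exp (slyPrefA α β (α ^ 2) (β ^ 2) / 2) *
          (Real.exp (slyPrefB α' β' (α' ^ 2) (β' ^ 2) (α' * (1 - α' - β')) / 2) / Real.sqrt (slyK3 α' β')) ^ q *
          (Real.exp (slyPrefB α β (α ^ 2) (β ^ 2) (α * (1 - α - β)) / 2) / Real.sqrt (slyK3 α β)) /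
          Real.sqrt (slySAgen q ((n : ℝ) / N) α β α' β' * slySCgen q ((n : ℝ) / N) α β α' β' -
            slySBgen q ((n : ℝ) / N) α β α' β' ^ 2)) *
        (Real.exp (48 * n * (c₀ * w) ^ 3 / m ^ 4 + 8 * (c₀ * w) / (m ^ 2 / 2) / 2 + 2 / (μ : ℝ)) *
          (Real.exp (180 * N * (2 * w) ^ 3 / m' ^ 4 + 19 * (2 * w) / (2 * (m' ^ 2 / 2)) + 11 / (6 * (μ' : ℝ))) *
              (1 + 2 / (rexp (π ^ 2 / (slyK3 α' β' / (2 * N))) - 1)) +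
            ((N : ℝ) + 1) * Real.exp (-(N * κ * w ^ 2 / (2 * (q + 1 : ℕ))) + 5 * (Real.log N / 2 + 2)) /
              (Real.exp (slyPrefB α' β' (α' ^ 2) (β' ^ 2) (α' * (1 - α' - β')) / 2) / Real.sqrt (slyK3 α' β'))) ^ q *
          (Real.exp (180 * n * (2 * w) ^ 3 / m ^ 4 + 19 * (2 * w) / (2 * (m ^ 2 / 2)) + 11 / (6 * (μ : ℝ))) *
              (1 + 2 / (rexp (π ^ 2 / (slyK3 α β / (2 * n))) - 1)) +
            ((n : ℝ) + 1) * Real.exp (-(n * κ * w ^ 2 / (2 * (q + 1 : ℕ))) + 5 * (Real.log n / 2 + 2)) /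
              (Real.exp (slyPrefB α β (α ^ 2) (β ^ 2) (α * (1 - α - β)) / 2) / Real.sqrt (slyK3 α β))) *
          Real.exp (120 * q * (3 * (((q + 1 : ℕ) : ℝ) + 2) / m' ^ 5 + 6 / m' ^ 5) * c₀ * w * mm) *
          ((1 + 2 / (rexp (π ^ 2 / (slySCgen q ((n : ℝ) / N) α β α' β' / (2 * n))) - 1)) *
            (1 + 2 / (rexp (π ^ 2 / ((slySAgen q ((n : ℝ) / N) α β α' β' * slySCgen q ((n : ℝ) / N) α β α' β' -
              slySBgen q ((n : ℝ) / N) α β α' β' ^ 2) / (2 * n * slySCgen q ((n : ℝ) / N) α β α' β'))) - 1)))) +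
      ((n : ℝ) + 1) ^ 2 * (((N : ℝ) + 1) ^ q * ((n : ℝ) + 1) *
        Real.exp (5 * q * (Real.log N / 2 + 2) + 7 * (Real.log n / 2 + 2) -
          (n * (κ / 2 * (c₀ * w / 8) ^ 2) - 14 * mm * (1 + Real.log N)))) := by
  classical
  have hn0 : 0 < n := hn
  have hN0 : 0 < N := by omega
  have hnR : (0 : ℝ) < n := by exact_mod_cast hn0
  have hNR : (0 : ℝ) < N := by exact_mod_cast hN0
  -- abbreviations
  set At := slySAgen q ((n : ℝ) / N) α β α' β' with hAt
  set Bt := slySBgen q ((n : ℝ) / N) α β α' β' with hBt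
  set Ct := slySCgen q ((n : ℝ) / N) α β α' β' with hCt'
  set KB : ℝ := Real.exp (slyPrefB α β (α ^ 2) (β ^ 2) (α * (1 - α - β)) / 2) / Real.sqrt (slyK3 α β)
    with hKB
  set KB' : ℝ := Real.exp (slyPrefB α' β' (α' ^ 2) (β' ^ 2) (α' * (1 - α' - β')) / 2) / Real.sqrt (slyK3 α' β')
    with hKB'
  set Err : ℝ := Real.exp (48 * n * (c₀ * w) ^ 3 / m ^ 4 + 8 * (c₀ * w) / (m ^ 2 / 2) / 2 + 2 / (μ : ℝ)) *
    (Real.exp (180 * N * (2 * w) ^ 3 / m' ^ 4 + 19 * (2 * w) / (2 * (m' ^ 2 / 2)) + 11 / (6 * (μ' : ℝ))) *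
        (1 + 2 / (rexp (π ^ 2 / (slyK3 α' β' / (2 * N))) - 1)) +
      ((N : ℝ) + 1) * Real.exp (-(N * κ * w ^ 2 / (2 * (q + 1 : ℕ))) + 5 * (Real.log N / 2 + 2)) / KB') ^ q *
    (Real.exp (180 * n * (2 * w) ^ 3 / m ^ 4 + 19 * (2 * w) / (2 * (m ^ 2 / 2)) + 11 / (6 * (μ : ℝ))) *
        (1 + 2 / (rexp (π ^ 2 / (slyK3 α β / (2 * n))) - 1)) +
      ((n : ℝ) + 1) * Real.exp (-(n * κ * w ^ 2 / (2 * (q + 1 : ℕ))) + 5 * (Real.log n / 2 + 2)) / KB) with hErr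
  set EΞ : ℝ := Real.exp (120 * q * (3 * (((q + 1 : ℕ) : ℝ) + 2) / m' ^ 5 + 6 / m' ^ 5) * c₀ * w * mm) with hEΞ
  set Far : ℝ := ((N : ℝ) + 1) ^ q * ((n : ℝ) + 1) *
    Real.exp (5 * q * (Real.log N / 2 + 2) + 7 * (Real.log n / 2 + 2) -
      (n * (κ / 2 * (c₀ * w / 8) ^ 2) - 14 * mm * (1 + Real.log N))) with hFarDef
  set Const : ℝ := (2 * π * n)⁻¹ * Real.exp (slyPrefA α β (α ^ 2) (β ^ 2) / 2) * KB' ^ q * KB with hConst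
  have hκ3 := slyK3_pos hα0 hβ0 hαβ
  have hκ3' := slyK3_pos hα0' hβ0' hαβ'
  have hKB0 : 0 < KB := div_pos (Real.exp_pos _) (Real.sqrt_pos.mpr hκ3)
  have hKB0' : 0 < KB' := div_pos (Real.exp_pos _) (Real.sqrt_pos.mpr hκ3')
  have h1τ : 1 ≤ 1 + 2 / (rexp (π ^ 2 / (slyK3 α β / (2 * n))) - 1) := one_le_thetaFactor (by positivity)
  have h1τ' : 1 ≤ 1 + 2 / (rexp (π ^ 2 / (slyK3 α' β' / (2 * N))) - 1) := one_le_thetaFactor (by positivity)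
  have hErr0 : 0 ≤ Err := by positivity
  have hConst0 : 0 ≤ Const := by positivity
  have hFar0 : 0 ≤ Far := by positivity
  -- split the double sum
  set P := (range (a + 1)) ×ˢ (range (b + 1)) with hP
  set Near := P.filter (fun p : ℕ × ℕ => |(p.1 : ℝ) / n - α ^ 2| + |(p.2 : ℝ) / n - β ^ 2| ≤ c₀ * w)
    with hNear
  set FarS := P.filter (fun p : ℕ × ℕ => ¬ |(p.1 : ℝ) / n - α ^ 2| + |(p.2 : ℝ) / n - β ^ 2| ≤ c₀ * w)
    with hFarS
  set F : ℕ × ℕ → ℝ := fun p => slyAcoef n a b p.1 p.2 *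
    slyRho N (a + ep) (b + em) (p.1 + ep) (p.2 + em) ^ q * slyRho n a b p.1 p.2 with hF
  have hsplit : slyRatioGen n N q a b ep em = ∑ p ∈ Near, F p + ∑ p ∈ FarS, F p := by
    unfold slyRatioGen
    rw [← Finset.sum_product (s := range (a + 1)) (t := range (b + 1))
      (f := fun p : ℕ × ℕ => slyAcoef n a b p.1 p.2 *
        slyRho N (a + ep) (b + em) (p.1 + ep) (p.2 + em) ^ q * slyRho n a b p.1 p.2), ← hP, hNear, hFarS,
      Finset.sum_filter_add_sum_filter_not]
  rw [hsplit]
  set G : ℕ × ℕ → ℝ := fun p => Real.exp (-((At * ((p.1 : ℝ) - n * α ^ 2) ^ 2 +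
      2 * Bt * ((p.1 : ℝ) - n * α ^ 2) * ((p.2 : ℝ) - n * β ^ 2) + Ct * ((p.2 : ℝ) - n * β ^ 2) ^ 2) /
      (2 * n))) with hG
  -- NEAR
  have hnearT : ∀ p ∈ Near, F p ≤ G p * Const * Err * EΞ := by
    intro p hp
    rw [hNear, mem_filter, hP, mem_product, mem_range, mem_range, Nat.lt_succ_iff, Nat.lt_succ_iff] at hp
    obtain ⟨⟨hga, hhb⟩, hnear⟩ := hp
    have := slyNearGen_gauss_le q hn hNn hep hem hmmn hga hhb hb2 habN hb2' habN' hα hβ hα0 hβ0 hαβ hα'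
      hβ' hα0' hβ0' hαβ' hm hm' hκ hw hc₀ hc₀1 hPD hPD' hgap hgap' hr₀ hr₀m' hr₀κ hr₀κm' hQ hQ' hcube hcube'
      hηw hηw' hw2 hw2' hμ1 hμ hμ1' hμ' hshift hnear
    rw [hF, hG, hConst, hErr, hEΞ]
    simpa only [mul_assoc] using this
  have hNearSum : ∑ p ∈ Near, F p ≤ (∑ p ∈ Near, G p) * (Const * Err * EΞ) := by
    rw [sum_mul]
    refine sum_le_sum fun p hp => ?_
    have := hnearT p hp
    linarith [this]
  have hGauss : ∑ p ∈ Near, G p ≤ 2 * π * n / Real.sqrt (At * Ct - Bt ^ 2) *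
      ((1 + 2 / (rexp (π ^ 2 / (Ct / (2 * n))) - 1)) *
        (1 + 2 / (rexp (π ^ 2 / ((At * Ct - Bt ^ 2) / (2 * n * Ct))) - 1))) := by
    have h := sum_gauss2_le hCt hDt hnR (n * α ^ 2) (n * β ^ 2)
      (Near.image fun p : ℕ × ℕ => ((p.1 : ℤ), (p.2 : ℤ)))
    rw [sum_image (fun p _ q _ hpq => by
      simp only [Prod.mk.injEq, Nat.cast_inj] at hpq; exact Prod.ext hpq.1 hpq.2)] at h
    simpa [hG] using h
  -- FAR
  have hfarT : ∀ p ∈ FarS, F p ≤ Far := by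
    intro p hp
    rw [hFarS, mem_filter, hP, mem_product, mem_range, mem_range, Nat.lt_succ_iff, Nat.lt_succ_iff,
      not_le] at hp
    obtain ⟨⟨hga, hhb⟩, hfar⟩ := hp
    exact slyFarGen_le q hn hNn hep hem hmmn hga hhb hb2 habN hb2' habN' hα hβ hα0 hβ0 hαβ hα' hβ' hα0'
      hβ0' hαβ' hm hm' hκ hw hc₀ hc₀1 hPD hPD' hgap hgap' hr₀ hr₀m' hr₀c hr₀cm' hηw hηw' hshift hfar
  have hFarSum : ∑ p ∈ FarS, F p ≤ ((n : ℝ) + 1) ^ 2 * Far := by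
    refine le_trans (sum_le_sum hfarT) ?_
    rw [sum_const, nsmul_eq_mul]
    have hcard : (FarS.card : ℝ) ≤ ((n : ℝ) + 1) ^ 2 := by
      have h1 : FarS.card ≤ P.card := card_filter_le _ _
      have h2 : P.card = (a + 1) * (b + 1) := by rw [hP, card_product, card_range, card_range]
      have h3 : (a + 1) * (b + 1) ≤ (n + 1) * (n + 1) := Nat.mul_le_mul (by omega) (by omega)
      have : (FarS.card : ℝ) ≤ ((n + 1) * (n + 1) : ℕ) := by exact_mod_cast (h1.trans (h2 ▸ h3))
      push_cast at this; nlinarith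
    exact mul_le_mul_of_nonneg_right hcard hFar0
  -- assemble
  have hmain : (∑ p ∈ Near, G p) * (Const * Err * EΞ) ≤
      (2 * π * n / Real.sqrt (At * Ct - Bt ^ 2) *
        ((1 + 2 / (rexp (π ^ 2 / (Ct / (2 * n))) - 1)) *
          (1 + 2 / (rexp (π ^ 2 / ((At * Ct - Bt ^ 2) / (2 * n * Ct))) - 1)))) * (Const * Err * EΞ) :=
    mul_le_mul_of_nonneg_right hGauss (by positivity)
  have e1 : (2 * π * n / Real.sqrt (At * Ct - Bt ^ 2) *
        ((1 + 2 / (rexp (π ^ 2 / (Ct / (2 * n))) - 1)) *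
          (1 + 2 / (rexp (π ^ 2 / ((At * Ct - Bt ^ 2) / (2 * n * Ct))) - 1)))) * (Const * Err * EΞ) =
      (Real.exp (slyPrefA α β (α ^ 2) (β ^ 2) / 2) * KB' ^ q * KB / Real.sqrt (At * Ct - Bt ^ 2)) *
        (Err * EΞ * ((1 + 2 / (rexp (π ^ 2 / (Ct / (2 * n))) - 1)) *
          (1 + 2 / (rexp (π ^ 2 / ((At * Ct - Bt ^ 2) / (2 * n * Ct))) - 1)))) := by
    rw [hConst]
    have hπ : (π : ℝ) ≠ 0 := Real.pi_pos.ne'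
    have hs : Real.sqrt (At * Ct - Bt ^ 2) ≠ 0 := (Real.sqrt_pos.mpr hDt).ne'
    field_simp
  linarith [hNearSum, hFarSum, hmain, e1.le, e1.ge]

end ExplicitGen

end Literature.Computability.Complexity
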